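import Literature.MathematicalPhysics.QuantumFieldTheory.Balaban1983to89.B9Thm34GKernelFinal

/-!
# `Balaban1983to89.B9Thm34SectBFinal` — [Balaban1985BackgroundPropagators] THEOREM 3.4 p. 400, THE SECT. B STEP FOR ALL THREE OPERATOR
# FAMILIES `G′(U′U)`, `(Q′G′²Q′*)⁻¹(U′U)`, `G(U′U)` WITH THE PRINTED QUANTIFIERS `∃ α₁ > 0 ∃ B ∀ A` (sup entries (3.42) in block-majorant
# form, (3.48) and Theorem 3.3's (3.42) in the printed kernel form) — FILE 26 of the Sect. B programme of cell `lit-balaban`, seat r06 gen 14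

statement-level skeleton of published theorems with citation tags; proofs where landed; nothing here is a claim about the Yang–Mills mass gap

CITATION HEADER (lean-in-tree rule).  B9 = T. Bałaban, *Propagators for lattice gauge theories in a background field*, Commun. Math. Phys. **99** (1985)
389–434 (journal page = PDF page + 388).  Theorem 3.4 p. 400 [PDF 12] «There exists a positive constant a₁ such that the operators G′(U), (Q′(U)G′²(U)Q′*(U))⁻¹, R(U), G(U) extend to configurations U′U for
α₁ ≦ a₁ as analytic functions of A. The extended operators satisfy all the inequalities of Theorems 3.1–3.3 correspondingly»
(verbatim p. 400 [PDF 12] L7–10; «for α₁ sufficiently small» is pp. 401–403, «of course with different constants» is p. 403 [PDF 15] L5 —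
docfix r06 g14 for S-B9-g38-2 / S-B9-g42-1 / CITELOC18: the earlier guillemet text here was a paraphrase, not the print); p. 402 [PDF 14] «Let us assume that Theorem 3.1 is valid for G′(U)», (3.62)–(3.65) (`G′(U′U) = G′(U)(I − V′(A)G′(U))⁻¹`);
p. 403 [PDF 15] (3.65)–(3.67) «The inverse satisfies Theorem 3.2»; Thm 3.1 (3.42) p. 397 [PDF 9]; Thm 3.2 (3.48) p. 398 [PDF 10] «|(Q′G′²Q′*)⁻¹(y,y′)| ≦
B₀(Lʲη)⁻⁴(L^{j′}η)^{−d}exp(−δ₀d(y,y′))»; (3.24) p. 394 (`G′ = (Δ′_a)⁻¹`); (3.84)–(3.86) p. 407; Thm 3.3 p. 399.  [4] = [Balaban1984PropagatorsII]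
Lemma 2.1 p. 234, (2.51)–(2.55) p. 232, (2.66) p. 234; [B11] = [Balaban1985Variational] (135) p. 298.  Rows B9.Thm3.4 × B9.Thm3.1 × B9.Thm3.2 ×
B9.Eq3.62 × B9.Eq3.66 × B9.Thm3.3 (cells only; no row head changes).

WHAT IS PROVED (0 `def`, 0 sorry, 0 new named facts).
* §1 **`thm34_Gp_final`** — THE `G′(U′U)`-CLAUSE: given Theorem 3.1 for `G′(U)` at the rate `δ₀` ((3.24) two-sided inverse of a letter
  `Δ′_a(U)`, (3.42)₁₋₃ block majorants), [4] Lemma 2.1 and the p. 398 scale transfer for every exponent, the `A`-free (3.19)/(3.24)/(3.60) data: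
  `∃ a₁ > 0 ∃ B ≧ 0 ∀ α₁ ≦ a₁ ∀ A` in (3.37) (blockwise) `∀ kF sF`: `G′(U′U) := gPrimeExtEnd G′(U) (V′(A)G′(U))` ((3.64)) IS the two-sided inverse
  of `Δ′_a(U) − V′(A)` ((3.60)/(3.62)) and EVERY left entry `X·G′(U) ≺ B_G P e^{−δ₀d}` / right entry `G′(U)·Y ≺ B_G Lʲη e^{−δ₀d}` transfers to
  `G′(U′U)` at `(B, 9δ₀/10)` — gen 9's `B9Ineq363Vprime.thm34_Gp_entries13_vPrime` / `gpExt_leftEntry_vPrime` / `gpExt_rightEntry_vPrime` with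
  the two smallness conditions `θ₃₆₃c₁ < 1`, `θ_Lc₁ < 1` discharged by continuity at `α₁ = 0`.
* §2 **`thm34_Cinv_final`** — THE `(Q′G′²Q′*)⁻¹(U′U)`-CLAUSE IN THE PRINTED KERNEL FORM (3.48): given Theorem 3.1 (3.42)₁,₂ for `G′(U)` and
  Theorem 3.2 for `U` ((3.21) `hLinv`, (3.48) kernel bound `B₁`) at `δ₀`, the (3.19) letters: `∃ a₁ > 0 ∀ α₁ ≦ a₁ ∀ A … ∀` (3.57)/(3.59) letters:
  `∃ C⁻¹(U′U)` two-sided inverse of `Q′(U′U)G′²(U′U)Q′*(U′U)` with `|C⁻¹(U′U)(y,y′)| ≦ 2B₁c₁(2δ₀/5, 1/10)·(Lʲη)⁻⁴(L^{j′}η)^{−d}e^{−(9δ₀/25)d(y,y′)}`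
  — an `α₁`-FREE explicit constant (gen 9's `B9Ineq366Vprime.inverse_satisfies_thm32_vPrime` with FILE 20's cascade and thresholds).
* §3 **`thm34_sectB_final`** — THE THREE CLAUSES TOGETHER under FILE 24/25's hypotheses + `Δ′_a(U)`: `∃ a₁ > 0 ∃ B ≧ 0 ∀ α₁ ≦ a₁ ∀ A …`:
  §1's conclusions for `G′(U′U)`, and `∃ C⁻¹(U′U), G(U′U)` with §2's kernel bound for THAT `C⁻¹(U′U)` (uniqueness of the two-sided inverse,
  Mathlib `left_inv_eq_right_inv`) and FILE 25's `thm34_G_kernel_final` conclusions for `G(U′U)` (two-sided inverse of the concrete `Δ_a(U′U)` whose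
  `P′(A)` carries this `C⁻¹(U′U)`; every left/right (3.42)-entry in block-majorant form; all four entries in the printed kernel form) — ONE `a₁`, ONE `B`.

HONEST SCOPE / NOT CLAIMED.  As FILES 20/24/25: Theorems 3.1–3.3 FOR `U` are inputs («assume Theorem 3.1 is valid for G′(U)», p. 402), here
including the letter `Δ′_a(U)` with `Δ′_a(U)G′(U) = G′(U)Δ′_a(U) = 1` ((3.24)); (3.37) is read blockwise in the shapes of FILES 1–19; the (3.15)/
(3.19)/(3.57)/(3.59)/(3.80)–(3.81) letters are block-majorant hypotheses of the printed shape; the `R(U′U)`-clause of Theorem 3.4 is implicit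
(`P(U′U) = P(U) + P′(A)` inside `Δ_a(U′U)`, no separate bound stated); Hölder / L² / global entries (3.43)–(3.47) not covered (the transfer
(3.42) ⇒ (3.47) is `B9Ineq347AllEntries`/`B9Ineq347GpExt`); `a₁`, `B` packaged existentially AFTER the lattice is fixed (values depend on the
constants only, FILE 20 (iii)); the rates `9δ₀/10`, `9δ₀/25`, `δ₀/6`, `δ₀/10` are ONE admissible choice («of course with different constants», p. 403); analyticity
in `A` = finite-lattice algebra (the Neumann series (3.64)/(3.86) are the inverses; `B9Eq373V3Analytic` has the analytic-function reading); no row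
head changes.

RELATED IN THE TREE, NOT DUPLICATED (searched 2026-08-22: `lean search 'thm34_Gp_final|thm34_Cinv_final|sectB_final' --decl` = ∅): gen 9
`B9Ineq363Vprime`/`B9Ineq366Vprime`, FILE 20 `B9Thm34GFinal` (§1 rescaling lemmas, `exists_threshold_of_continuousAt`, `neumann_le_two`), FILE 25
`B9Thm34GKernelFinal.thm34_G_kernel_final` USED BY NAME.
-/

noncomputable section

namespace Literature.MathematicalPhysics.QuantumFieldTheory.Balaban1983to89.B9Thm34SectBFinal

open NormedSpace Complex
open Literature.MathematicalPhysics.QuantumFieldTheory.Balaban1983to89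
open Literature.MathematicalPhysics.QuantumFieldTheory.Balaban1983to89.B6RandomWalk (HasMajorant hasMajorant_mono Triangle254 Ineq261)
open Literature.MathematicalPhysics.QuantumFieldTheory.Balaban1983to89.B6RandomWalkHom (HasMajorantHom hasMajorantHom_mono hasMajorantHom_iff
  hasMajorantHom_zero)
open Literature.MathematicalPhysics.QuantumFieldTheory.Balaban1983to89.B6RandomWalkKernel (HasKernelBound hasKernelBound_mono)
open Literature.MathematicalPhysics.QuantumFieldTheory.Balaban1983to89.B9Thm34Ext (toB6)
open Literature.MathematicalPhysics.QuantumFieldTheory.Balaban1983to89.B9Ineq347 (ScaleTransfer)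
open Literature.MathematicalPhysics.QuantumFieldTheory.Balaban1983to89.B9Ineq366CPrime (hasMajorant_rate_mono kappa366 kappa366_nonneg kappa366_pos)
open Literature.MathematicalPhysics.QuantumFieldTheory.Balaban1983to89.B9Eq386Neumann (pTwo deltaA)
open Literature.MathematicalPhysics.QuantumFieldTheory.Balaban1983to89.B9Ineq385VG (kappa385 kappa385_nonneg)
open Literature.MathematicalPhysics.QuantumFieldTheory.Balaban1983to89.B9Eq39Adjoint
open Literature.MathematicalPhysics.QuantumFieldTheory.Balaban1983to89.B9Eq369Small (Through)
open Literature.MathematicalPhysics.QuantumFieldTheory.Balaban1983to89.B9Eq372Locality (stBonds)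
open Literature.MathematicalPhysics.QuantumFieldTheory.Balaban1983to89.B9Eq352DivForm (tauF tauB)
open Literature.MathematicalPhysics.QuantumFieldTheory.Balaban1983to89.B9Eq352DivFormLetters
open Literature.MathematicalPhysics.QuantumFieldTheory.Balaban1983to89.B9Eq352GradLetters (diffLetter)
open Literature.MathematicalPhysics.QuantumFieldTheory.Balaban1983to89.B9Eq371GradLetters (bT bU)
open Literature.MathematicalPhysics.QuantumFieldTheory.Balaban1983to89.B9Eq372RemLetters (lapDDLetter)
open Literature.MathematicalPhysics.QuantumFieldTheory.Balaban1983to89.B9Eq382V3Letters (dPrimeLetter)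
open Literature.MathematicalPhysics.QuantumFieldTheory.Balaban1983to89.B9Eq376POneLetters (conjHom gradLin divLin)
open Literature.MathematicalPhysics.QuantumFieldTheory.Balaban1983to89.B9Ineq385V3Concrete (cV385 cV385_nonneg)
open Literature.MathematicalPhysics.QuantumFieldTheory.Balaban1983to89.B9Eq360Vprime (gPrimeExtEnd)
open Literature.MathematicalPhysics.QuantumFieldTheory.Balaban1983to89.B9Eq360VprimeLetters (vPrimeConc cBConc cCConc)
open Literature.MathematicalPhysics.QuantumFieldTheory.Balaban1983to89.B9Ineq363Vprime (cVConc cVConc_nonneg theta363 thetaL363 theta363_nonneg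
  thetaL363_nonneg thm34_Gp_entries13_vPrime gpExt_leftEntry_vPrime gpExt_rightEntry_vPrime)
open Literature.MathematicalPhysics.QuantumFieldTheory.Balaban1983to89.B6RandomWalkSection (secExt secRes secConj)
open Literature.MathematicalPhysics.QuantumFieldTheory.Balaban1983to89.B9Ineq366Vprime (inverse_satisfies_thm32_vPrime)
open Literature.MathematicalPhysics.QuantumFieldTheory.Balaban1983to89.B9Thm34GFinal (ineq261_rescale scaleTransfer_rescale c1_pos_of_ineq261
  exists_threshold_of_continuousAt neumann_le_two)
open Literature.MathematicalPhysics.QuantumFieldTheory.Balaban1983to89.B9Thm34GKernelFinal (thm34_G_kernel_final)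

/-! ## §1  Theorem 3.4, the `G′(U′U)`-clause with the printed quantifiers -/

section Gp

variable {𝔸 : Type*} [NormedRing 𝔸] [NormedAlgebra ℂ 𝔸] [CompleteSpace 𝔸] {ι : Type} [Fintype ι]
variable (b : Module.Basis ι ℝ 𝔸) {S : Type} {κ : Type} [Fintype κ] [LinearOrder κ]
variable (T : κ → Equiv.Perm S) (U : κ → S → 𝔸ˣ)
variable {g : B9.Geometry} [Fintype g.Site] {Rr : ℝ} {H : Prop}

omit [LinearOrder κ] in
set_option maxHeartbeats 800000 in
/-- **THEOREM 3.4, `G′(U′U)`-CLAUSE, CONCRETE PERTURBATION, PRINTED QUANTIFIERS** — «Let us assume that Theorem 3.1 is valid for G′(U) …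
G′(U′U) = G′(U)(I − V′(A)G′(U))⁻¹ … The series converges in all the norms of Theorem 3.1. We define new constants in such a way that the statements of
Theorem 3.1 hold for extended operators» (pp. 402–403): `∃ a₁ > 0 ∃ B ≧ 0 ∀ α₁ ≦ a₁ ∀ A` in (3.37) (blockwise) `∀ kF sF` ((3.59) kernels):
`G′(U′U) := gPrimeExtEnd G′(U) (V′(A)G′(U))` is the two-sided inverse of `Δ′_a(U) − V′(A)` ((3.60)/(3.62); `V′(A)` the concrete
`B9Eq360VprimeLetters.vPrimeConc`) and every left entry `X·G′(U) ≺ B_G P(y)e^{−δ₀d}` (`P ≧ 0`; (3.42)₁ `X = 1, P = (Lʲη)²`; (3.42)₂ `X = ∇_k, P = Lʲη`)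
/ right entry `G′(U)·Y ≺ B_G Lʲη e^{−δ₀d}` ((3.42)₃ `Y = ∇*_l`) transfers to `G′(U′U)` at `(B, 9δ₀/10)`, `B = 2B_GΛ_ρ²c₁(49δ₀/50, 1/100)`.  Inputs:
Theorem 3.1 for `G′(U)` ((3.24) inverse of the letter `Δ′_a(U)`; (3.42)₁₋₃ at `δ₀`), [4] Lemma 2.1 at `δ₀` for every exponent, the p. 398 scale
transfer for every exponent, the (3.19)/(3.24)/(3.60) data; thresholds `θ₃₆₃c₁ < ½`, `θ_Lc₁ < ½` by continuity at `α₁ = 0`.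
[cite: Balaban1985BackgroundPropagators, Thm 3.4 p.400 + (3.60)–(3.65) p.402 + p.403 + Thm 3.1 (3.42) p.397 + p.398 remark + (3.24) p.394 + (3.19) p.393 + (3.59) p.402 + (3.37) p.396; Balaban1984PropagatorsII, Lemma 2.1 p.234 + (2.66) p.234] -/
theorem thm34_Gp_final [Fintype S] [DecidableEq S] [DecidableEq ι] [DecidableEq g.Site] [Nonempty g.Site] (blk : S → g.Site) (d : ℕ)
    (δ₀ BG Cq a₀ d₀ M₂ : ℝ)
    (kQ : g.Site → S → 𝔸 →L[ℝ] 𝔸) (sQ : S → 𝔸 →L[ℝ] 𝔸) (cfun w : g.Site → ℝ)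
    (hBG : 0 < BG) (hCq : 0 ≤ Cq) (ha₀ : 0 ≤ a₀) (hM₂ : 0 ≤ M₂) (hδ₀ : 0 < δ₀)
    -- the multiscale geometry 𝔅 (p. 393, [4] (2.1)–(2.4)) and its axioms
    (hdnn : ∀ a a' : g.Site, 0 ≤ g.dist a a') (htri : Triangle254 (toB6 g Rr H)) (hrefl : ∀ y : g.Site, g.dist y y = 0)
    (hsym : ∀ y y' : g.Site, g.dist y y' = g.dist y' y) (hlen : ∀ y : g.Site, 0 < g.len y) (hlenη : ∀ y : g.Site, g.eta ≤ g.len y)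
    (hη : 0 < g.eta)
    -- [4] Lemma 2.1 (2.61) at the rate `δ₀`, «for every 0 < α < 1», and the p. 398 scale transfer for every exponent
    (h261 : ∀ α : ℝ, 0 < α → α < 1 → Ineq261 d (toB6 g Rr H) δ₀ α)
    (hST : ∀ α : ℝ, 0 < α → ∃ Λ : ℝ, 1 ≤ Λ ∧ ScaleTransfer g δ₀ α Λ (fun a => g.len a) ∧ ScaleTransfer g δ₀ α Λ (fun a => g.len a ^ 2) ∧
      ScaleTransfer g δ₀ α Λ (fun a => (g.len a)⁻¹) ∧ ScaleTransfer g δ₀ α Λ (fun a => (g.len a ^ 2)⁻¹) ∧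
      ScaleTransfer g δ₀ α Λ (fun a => (g.len a ^ 4)⁻¹) ∧ ScaleTransfer g δ₀ α Λ (fun y => g.len y ^ (-(4 : ℝ))))
    (hrepr : ∀ (v : 𝔸) (i : ι), |b.repr v i| ≤ M₂ * ‖v‖)
    (hU1 : ∀ m z, ‖((U m z : 𝔸ˣ) : 𝔸)‖ ≤ 1 ∧ ‖(((U m z)⁻¹ : 𝔸ˣ) : 𝔸)‖ ≤ 1)
    (hd₀B : ∀ μ x, g.dist (blk x) (blk ((T μ).symm x)) ≤ d₀) (hd₀F : ∀ μ x, g.dist (blk x) (blk (T μ x)) ≤ d₀)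
    (hd₀0 : ∀ y : g.Site, g.dist y y ≤ d₀)
    -- the `A`-independent data of the concrete `V′(A)` of (3.60)
    (hw : ∀ y, 0 ≤ w y) (hcard : ∀ y, ((B9Eq360Vprime.block blk y).card : ℝ) * w y ≤ 1)
    (hkQ : ∀ y x, blk x = y → ‖kQ y x‖ ≤ w y) (hsQ : ∀ x, ‖sQ x‖ ≤ 1) (hcfun : ∀ y, |cfun y| ≤ a₀ * (g.len y ^ 2)⁻¹)
    -- THEOREM 3.1 for `G′(U)`: (3.24) `G′(U) = (Δ′_a(U))⁻¹` for the letter `Δ′_a(U)`, and (3.42)₁,₂,₃ at the rate `δ₀`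
    {Δp Gp : Module.End ℝ (S × ι → ℝ)} (hΔpGp : Δp * Gp = 1) (hGpΔp : Gp * Δp = 1)
    (h342_1 : HasMajorant (g := toB6 g Rr H) (fun p : S × ι => blk p.1) Gp
      (fun a a' => BG * g.len a ^ 2 * Real.exp (-(δ₀ * g.dist a a'))))
    (h342_2 : ∀ k : κ ⊕ κ, HasMajorant (g := toB6 g Rr H) (fun p : S × ι => blk p.1)
      (conj b (diffLetter T U ((g.eta : ℂ)⁻¹) k) * Gp) (fun a a' => BG * g.len a * Real.exp (-(δ₀ * g.dist a a'))))
    (h342_3 : ∀ k : κ ⊕ κ, HasMajorant (g := toB6 g Rr H) (fun p : S × ι => blk p.1)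
      (Gp * conj b (diffLetter T U ((g.eta : ℂ)⁻¹) k)) (fun a a' => BG * g.len a * Real.exp (-(δ₀ * g.dist a a')))) :
    ∃ a₁ : ℝ, 0 < a₁ ∧ ∃ B : ℝ, 0 ≤ B ∧
    ∀ (α₁ : ℝ), 0 ≤ α₁ → α₁ ≤ a₁ →
    -- the exponent field `A` in the domain (3.37), read blockwise, and the `A`-dependent (3.59) data `kF`, `sF`
    ∀ (A : κ → S → 𝔸) (kF : g.Site → S → 𝔸 →L[ℝ] 𝔸) (sF : S → 𝔸 →L[ℝ] 𝔸),
      (∀ y x, blk x = y → ‖kF y x‖ ≤ Cq * α₁ * w y) → (∀ x, ‖sF x‖ ≤ Cq * α₁) →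
      (∀ ν k x, ‖((g.eta : ℂ)⁻¹) • covDstar T U ν (A k) x‖ ≤ α₁ * (g.len (blk x) ^ 2)⁻¹) →
      (∀ μ ν x, ‖((g.eta : ℂ)⁻¹) • covD T U μ (A ν) x‖ ≤ α₁ * (g.len (blk x) ^ 2)⁻¹) →
      (∀ μ x, ‖((g.eta : ℂ)⁻¹) • covDstar T U μ (tauB T U μ (A μ)) x‖ ≤ α₁ * (g.len (blk x) ^ 2)⁻¹) →
      (∀ k x, ‖A k x‖ ≤ α₁ * (g.len (blk x))⁻¹) → (∀ ν k x, ‖tauB T U ν (A k) x‖ ≤ α₁ * (g.len (blk x))⁻¹) →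
      (Δp - conj b (vPrimeConc T U g.eta A blk kQ kF sQ sF cfun)) * (gPrimeExtEnd Gp (conj b (vPrimeConc T U g.eta A blk kQ kF sQ sF cfun) * Gp)) = 1 ∧
      (gPrimeExtEnd Gp (conj b (vPrimeConc T U g.eta A blk kQ kF sQ sF cfun) * Gp)) * (Δp - conj b (vPrimeConc T U g.eta A blk kQ kF sQ sF cfun)) = 1 ∧
      (∀ (X : Module.End ℝ (S × ι → ℝ)) (P : g.Site → ℝ), (∀ y, 0 ≤ P y) →
        HasMajorant (g := toB6 g Rr H) (fun p : S × ι => blk p.1) (X * Gp) (fun a a' => BG * P a * Real.exp (-(δ₀ * g.dist a a'))) →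
        HasMajorant (g := toB6 g Rr H) (fun p : S × ι => blk p.1) (X * (gPrimeExtEnd Gp (conj b (vPrimeConc T U g.eta A blk kQ kF sQ sF cfun) * Gp)))
          (fun a a' => B * P a * Real.exp (-(9 / 10 * δ₀ * g.dist a a')))) ∧
      (∀ Y : Module.End ℝ (S × ι → ℝ),
        HasMajorant (g := toB6 g Rr H) (fun p : S × ι => blk p.1) (Gp * Y) (fun a a' => BG * g.len a * Real.exp (-(δ₀ * g.dist a a'))) →
        HasMajorant (g := toB6 g Rr H) (fun p : S × ι => blk p.1) ((gPrimeExtEnd Gp (conj b (vPrimeConc T U g.eta A blk kQ kF sQ sF cfun) * Gp)) * Y)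
          (fun a a' => B * g.len a * Real.exp (-(9 / 10 * δ₀ * g.dist a a')))) := by
  classical
  obtain ⟨y₀⟩ := ‹Nonempty g.Site›
  have hSb : 0 ≤ ∑ i, ‖b i‖ := Finset.sum_nonneg fun i _ => norm_nonneg _
  -- the p. 398 scale transfers and [4] Lemma 2.1 at the pairs `(δ₀, 1/100)`, `(49δ₀/50, 1/100)`
  obtain ⟨Λ, hΛ, hT1, hT2, hT1i, hT2i, -, -⟩ := hST (1 / 100) (by norm_num)
  obtain ⟨Λρ, hΛρ1, hTρ0, -, -, -, -, -⟩ := hST (1 / 100 * (49 / 50)) (by norm_num)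
  have hTρ : ScaleTransfer g (49 / 50 * δ₀) (1 / 100) Λρ (fun a => g.len a) := scaleTransfer_rescale hTρ0
  have hΛ0 : 0 < Λ := zero_lt_one.trans_le hΛ
  have hΛρ : 0 ≤ Λρ := zero_le_one.trans hΛρ1
  have h261β : Ineq261 d (toB6 g Rr H) δ₀ (1 / 100) := h261 _ (by norm_num) (by norm_num)
  have h261c : Ineq261 d (toB6 g Rr H) (49 / 50 * δ₀) (1 / 100) :=
    ineq261_rescale (h261 (1 / 100 * (49 / 50)) (by norm_num) (by norm_num))
  have hcc' : 0 < B6.c1 d (49 / 50 * δ₀) (1 / 100) := c1_pos_of_ineq261 h261c y₀ (hrefl y₀)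
  have hrc1 : 49 / 50 * δ₀ + (1 / 100 + 1 / 100) * δ₀ ≤ δ₀ := by linarith only [hδ₀]
  have hρc0 : 0 ≤ 49 / 50 * δ₀ := by linarith only [hδ₀]
  have hα'ρ : 0 ≤ (1 - 1 / 100) * (49 / 50 * δ₀) := by linarith only [hδ₀]
  have hα'ρ0 : 0 ≤ 1 / 100 * (49 / 50 * δ₀) := by linarith only [hδ₀]
  have hα'ρ2 : 0 ≤ (1 - 2 * (1 / 100)) * (49 / 50 * δ₀) := by linarith only [hδ₀]
  -- «for α₁ sufficiently small» (p. 402): `θ₃₆₃c₁`, `θ_Lc₁` are continuous at `α₁ = 0` and vanish there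
  obtain ⟨ε₁, hε₁, hF1⟩ := exists_threshold_of_continuousAt
    (f := fun α₁ : ℝ => theta363 (Fintype.card κ) 1 α₁ a₀ Cq M₂ (∑ i, ‖b i‖) (Real.exp (δ₀ * d₀)) BG Λ (B6.c1 d δ₀ (1 / 100)) * B6.c1 d (49 / 50 * δ₀) (1 / 100))
    (by unfold theta363 kappa385 cVConc cBConc; fun_prop) (by simp [theta363])
  obtain ⟨ε₂, hε₂, hF2⟩ := exists_threshold_of_continuousAt
    (f := fun α₁ : ℝ => thetaL363 (Fintype.card κ) 1 α₁ a₀ Cq M₂ (∑ i, ‖b i‖) (Real.exp (δ₀ * d₀)) BG Λ (B6.c1 d δ₀ (1 / 100)) * B6.c1 d (49 / 50 * δ₀) (1 / 100))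
    (by unfold thetaL363 kappa385 cVConc cBConc; fun_prop) (by simp [thetaL363])
  have hBnn : 0 ≤ 2 * BG * Λρ ^ 2 * B6.c1 d (49 / 50 * δ₀) (1 / 100) :=
    mul_nonneg (mul_nonneg (mul_nonneg zero_le_two hBG.le) (sq_nonneg Λρ)) hcc'.le
  refine ⟨min (min ε₁ ε₂) (1 / 2) / 2, half_pos (lt_min (lt_min hε₁ hε₂) one_half_pos), 2 * BG * Λρ ^ 2 * B6.c1 d (49 / 50 * δ₀) (1 / 100),
    hBnn, ?_⟩
  intro α₁ hα₁0 hα₁1 A kF sF hkF hsF h337B h337F h337Bτ hA hAτB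
  have hmε₁ : min (min ε₁ ε₂) (1 / 2) ≤ ε₁ := (min_le_left _ _).trans (min_le_left _ _)
  have hmε₂ : min (min ε₁ ε₂) (1 / 2) ≤ ε₂ := (min_le_left _ _).trans (min_le_right _ _)
  have hmh : min (min ε₁ ε₂) (1 / 2) ≤ 1 / 2 := min_le_right _ _
  have habs : |α₁| = α₁ := abs_of_nonneg hα₁0
  have h1 : theta363 (Fintype.card κ) 1 α₁ a₀ Cq M₂ (∑ i, ‖b i‖) (Real.exp (δ₀ * d₀)) BG Λ (B6.c1 d δ₀ (1 / 100)) * B6.c1 d (49 / 50 * δ₀) (1 / 100) < 1 / 2 :=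
    hF1 α₁ (by rw [habs]; linarith only [hα₁1, hmε₁, hε₁])
  have h2 : thetaL363 (Fintype.card κ) 1 α₁ a₀ Cq M₂ (∑ i, ‖b i‖) (Real.exp (δ₀ * d₀)) BG Λ (B6.c1 d δ₀ (1 / 100)) * B6.c1 d (49 / 50 * δ₀) (1 / 100) < 1 / 2 :=
    hF2 α₁ (by rw [habs]; linarith only [hα₁1, hmε₂, hε₂])
  have hhalf : (1 / 2 : ℝ) < 1 := by norm_num
  -- `η·α₁(Lʲη)⁻¹ ≦ 1/4` from `α₁ ≦ 1/4` and `η ≦ Lʲη`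
  have hsmall : ∀ y : g.Site, g.eta * (α₁ * (g.len y)⁻¹) ≤ 1 / 4 := fun y => by
    have hq : g.eta * (g.len y)⁻¹ ≤ 1 := by
      rw [← div_eq_mul_inv]; exact (div_le_one (hlen y)).mpr (hlenη y)
    calc g.eta * (α₁ * (g.len y)⁻¹) = α₁ * (g.eta * (g.len y)⁻¹) := by ring
      _ ≤ α₁ * 1 := mul_le_mul_of_nonneg_left hq hα₁0
      _ ≤ 1 / 4 := by linarith only [hα₁1, hmh]
  -- the shapes gen 9's `B9Ineq363Vprime` reads (3.37) / the stencil geometry in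
  have hA' : ∀ μ x, ‖A μ x‖ ≤ α₁ * (g.len (blk x))⁻¹ ∧ ‖tauB T U μ (A μ) x‖ ≤ α₁ * (g.len (blk x))⁻¹ :=
    fun μ x => ⟨hA μ x, hAτB μ μ x⟩
  have h337s' : ∀ μ x, ‖((g.eta : ℂ)⁻¹) • covDstar T U μ (A μ) x‖ ≤ α₁ * (g.len (blk x) ^ 2)⁻¹ := fun μ x => h337B μ μ x
  have h337F' : ∀ μ x, ‖((g.eta : ℂ)⁻¹) • covD T U μ (A μ) x‖ ≤ α₁ * (g.len (blk x) ^ 2)⁻¹ := fun μ x => h337F μ μ x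
  have hd₀' : ∀ μ x, g.dist (blk x) (blk (T μ x)) ≤ d₀ ∧ g.dist (blk x) (blk ((T μ).symm x)) ≤ d₀ :=
    fun μ x => ⟨hd₀F μ x, hd₀B μ x⟩
  -- a dummy right letter for gen 9's fourth conjunct (discarded; the universal right entries come from `gpExt_rightEntry_vPrime`)
  have hGDs0 : HasMajorant (g := toB6 g Rr H) (fun p : S × ι => blk p.1) (Gp * 0)
      (fun a a' => BG * g.len a * Real.exp (-(δ₀ * g.dist a a'))) := by
    rw [mul_zero]
    exact hasMajorant_mono (g := toB6 g Rr H) _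
      ((hasMajorantHom_iff (g := toB6 g Rr H) _ _ _).mp (hasMajorantHom_zero (g := toB6 g Rr H) _ _))
      fun a a' => mul_nonneg (mul_nonneg hBG.le (hlen a).le) (Real.exp_nonneg _)
  -- existence: `G′(U′U)` is the two-sided inverse of `Δ′_a(U) − V′(A)` (gen 9)
  obtain ⟨i1, i2, -, -⟩ := thm34_Gp_entries13_vPrime (Rr := Rr) (H := H) b T U blk d hη A kQ kF sQ sF cfun w 1 d₀ M₂ Cq a₀ δ₀ δ₀
    (1 / 100) (1 / 100) (49 / 50 * δ₀) Λ Λρ BG α₁ (1 / 100) hBG.le hα₁0 hΛ0.le hΛρ hρc0 (by norm_num) (by norm_num) hδ₀.le hδ₀.le hrc1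
    (by norm_num) hα'ρ hα'ρ0 hα'ρ2 hdnn hrefl hsym htri hlen h261β h261c hT1 hT2 hT1i hT2i hTρ hM₂ hrepr hsmall hA' h337s' h337F' h337Bτ
    hU1 hd₀' hd₀0 hw hcard hCq ha₀ hkQ hkF hsQ hsF hcfun (h1.trans hhalf) (h2.trans hhalf) Δp Gp hΔpGp hGpΔp (Ds := 0) h342_1 h342_2
    h342_3 hGDs0
  -- the rate and constant weakenings
  have hexpρ : ∀ a a' : g.Site, Real.exp (-(δ₀ * g.dist a a')) ≤ Real.exp (-(49 / 50 * δ₀ * g.dist a a')) := fun a a' => by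
    have h0 : 0 ≤ δ₀ * g.dist a a' := mul_nonneg hδ₀.le (hdnn a a')
    exact Real.exp_le_exp.mpr (by linarith only [h0])
  have hc0 : 0 ≤ BG * B6.c1 d (49 / 50 * δ₀) (1 / 100) := mul_nonneg hBG.le hcc'.le
  have hBle1 : BG * B6.c1 d (49 / 50 * δ₀) (1 / 100) * 2 ≤ 2 * BG * Λρ ^ 2 * B6.c1 d (49 / 50 * δ₀) (1 / 100) :=
    calc BG * B6.c1 d (49 / 50 * δ₀) (1 / 100) * 2 = 2 * (BG * B6.c1 d (49 / 50 * δ₀) (1 / 100)) * 1 := by ring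
      _ ≤ 2 * (BG * B6.c1 d (49 / 50 * δ₀) (1 / 100)) * Λρ ^ 2 := mul_le_mul_of_nonneg_left (one_le_pow₀ hΛρ1) (mul_nonneg zero_le_two hc0)
      _ = 2 * BG * Λρ ^ 2 * B6.c1 d (49 / 50 * δ₀) (1 / 100) := by ring
  have hBle3 : BG * Λρ ^ 2 * B6.c1 d (49 / 50 * δ₀) (1 / 100) * 2 ≤ 2 * BG * Λρ ^ 2 * B6.c1 d (49 / 50 * δ₀) (1 / 100) :=
    le_of_eq (by ring)
  refine ⟨i1, i2, fun X P hP0 hX => ?_, fun Y hY => ?_⟩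
  · -- every left entry, by gen 9's `gpExt_leftEntry_vPrime` (second form of (3.65))
    have hXρ : HasMajorantHom (g := toB6 g Rr H) (fun p : S × ι => blk p.1) (fun p : S × ι => blk p.1) (X ∘ₗ Gp)
        (fun a a' => BG * P a * Real.exp (-(49 / 50 * δ₀ * g.dist a a'))) :=
      hasMajorantHom_mono (g := toB6 g Rr H) _ _ ((hasMajorantHom_iff (g := toB6 g Rr H) _ _ _).mpr hX) fun a a' =>
        mul_le_mul_of_nonneg_left (hexpρ a a') (mul_nonneg hBG.le (hP0 a))
    have h := gpExt_leftEntry_vPrime (Rr := Rr) (H := H) b T U blk (fun p : S × ι => blk p.1) d hη A kQ kF sQ sF cfun w 1 d₀ M₂ Cq a₀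
      δ₀ δ₀ (1 / 100) (1 / 100) (49 / 50 * δ₀) Λ BG α₁ (1 / 100) P hBG.le hP0 hα₁0 hΛ0.le hρc0 (by norm_num) (by norm_num) hδ₀.le hδ₀.le
      hrc1 hα'ρ (by norm_num) hdnn hrefl htri hlen h261β h261c hT1 hT2 hM₂ hrepr hsmall hA' h337s' hU1 hd₀' hd₀0 hw hcard hCq ha₀ hkQ
      hkF hsQ hsF hcfun (h1.trans hhalf) (E := X) h342_1 h342_2 hXρ
    refine hasMajorant_mono (g := toB6 g Rr H) _ ((hasMajorantHom_iff (g := toB6 g Rr H) _ _ _).mp h) fun a a' => ?_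
    have h0 : 0 ≤ δ₀ * g.dist a a' := mul_nonneg hδ₀.le (hdnn a a')
    have hexp9 : Real.exp (-((1 - 1 / 100) * (49 / 50 * δ₀) * g.dist a a')) ≤ Real.exp (-(9 / 10 * δ₀ * g.dist a a')) :=
      Real.exp_le_exp.mpr (by linarith only [h0])
    exact mul_le_mul (mul_le_mul_of_nonneg_right ((mul_le_mul_of_nonneg_left (neumann_le_two h1) hc0).trans hBle1) (hP0 a))
      hexp9 (Real.exp_pos _).le (mul_nonneg hBnn (hP0 a))
  · -- every right entry, by gen 9's `gpExt_rightEntry_vPrime` (first form of (3.65))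
    have h := gpExt_rightEntry_vPrime (Rr := Rr) (H := H) b T U blk d hη A kQ kF sQ sF cfun w 1 d₀ M₂ Cq a₀ δ₀ δ₀ (1 / 100) (1 / 100)
      (49 / 50 * δ₀) Λ Λρ BG α₁ (1 / 100) hBG.le hα₁0 hΛ0.le hΛρ hρc0 (by norm_num) (by norm_num) hδ₀.le hδ₀.le hrc1 (by norm_num) hα'ρ
      hα'ρ0 hα'ρ2 hdnn hrefl hsym htri hlen h261β h261c hT1 hT2 hT1i hT2i hTρ hM₂ hrepr hsmall hA' h337s' h337F' h337Bτ hU1 hd₀' hd₀0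
      hw hcard hCq ha₀ hkQ hkF hsQ hsF hcfun (h1.trans hhalf) (h2.trans hhalf) (Ds := Y) h342_1 h342_2 h342_3 hY
    refine hasMajorant_mono (g := toB6 g Rr H) _ h fun a a' => ?_
    have h0 : 0 ≤ δ₀ * g.dist a a' := mul_nonneg hδ₀.le (hdnn a a')
    have hexp9 : Real.exp (-((1 - 3 * (1 / 100)) * (49 / 50 * δ₀) * g.dist a a')) ≤ Real.exp (-(9 / 10 * δ₀ * g.dist a a')) :=
      Real.exp_le_exp.mpr (by linarith only [h0])
    exact mul_le_mul (mul_le_mul_of_nonneg_right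
      ((mul_le_mul_of_nonneg_left (neumann_le_two h2) (mul_nonneg (mul_nonneg hBG.le (sq_nonneg Λρ)) hcc'.le)).trans hBle3) (hlen a).le)
      hexp9 (Real.exp_pos _).le (mul_nonneg hBnn (hlen a).le)

end Gp

/-! ## §2  Theorem 3.4, the `(Q′G′²Q′*)⁻¹(U′U)`-clause in the printed kernel form (3.48) with the printed quantifiers -/

section CInv

variable {𝔸 : Type*} [NormedRing 𝔸] [NormedAlgebra ℂ 𝔸] [CompleteSpace 𝔸] {ι : Type} [Fintype ι]
variable (b : Module.Basis ι ℝ 𝔸) {S : Type} {κ : Type} [Fintype κ] [LinearOrder κ]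
variable (T : κ → Equiv.Perm S) (U : κ → S → 𝔸ˣ)
variable {g : B9.Geometry} [Fintype g.Site] {Rr : ℝ} {H : Prop}

omit [LinearOrder κ] in
set_option maxHeartbeats 800000 in
/-- **THEOREM 3.4, `(Q′G′²Q′*)⁻¹(U′U)`-CLAUSE IN THE PRINTED KERNEL FORM (3.48), CONCRETE PERTURBATION, PRINTED QUANTIFIERS** — p. 403 «The
operator C′(A) is a small perturbation, thus we can invert the operator on the right side (for α₁ sufficiently small) … The inverse satisfies Theorem
3.2»: `∃ a₁ > 0 ∀ α₁ ≦ a₁ ∀ A` in (3.37) (blockwise) `∀ kF sF ∀` (3.57)/(3.59) letters `Q′(U′U) = Q′ + F′₂`, `Q′*(U′U) = Q′* + F′₂*` of size `c_Fα₁`: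
THERE EXISTS `C⁻¹(U′U)`, two-sided inverse of `Q′(U′U)G′²(U′U)Q′*(U′U)` on 𝔅 (`G′(U′U) = gPrimeExtEnd G′ (V′G′)`), with the KERNEL bound
`|C⁻¹(U′U)(y,y′)| ≦ 2B₁c₁(2δ₀/5, 1/10)·(Lʲη)⁻⁴(L^{j′}η)^{−d}e^{−(9δ₀/25)d(y,y′)}` — Theorem 3.2's shape (3.48) with an `α₁`-FREE constant.  Inputs: Theorem
3.1 (3.42)₁,₂ for `G′(U)` and Theorem 3.2 for `U` ((3.21) `hLinv`, (3.48) `B₁`) at `δ₀`, the (3.19) letters, [4] Lemma 2.1 at `δ₀` for every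
exponent, the p. 398 scale transfer; gen 9's `B9Ineq366Vprime.inverse_satisfies_thm32_vPrime` with FILE 20's cascade (`δ₁ = δ₀`, `ρ_c = 49δ₀/50`,
`α_c = 1/100`, `α_v = α₃ = 1/10`) and its thresholds `θ_c c₁ < ½`, `α₁·2κ_CB₁c₄c₁c₁ < ½` by continuity at `α₁ = 0`.
[cite: Balaban1985BackgroundPropagators, Thm 3.4 p.400 + Thm 3.2 (3.48) p.398 + p.403 + (3.57) p.401 + (3.58)–(3.67) pp.402–403 + (3.19)/(3.21) pp.393–394 + Thm 3.1 (3.42) p.397 + (3.37) p.396; Balaban1984PropagatorsII, Lemma 2.1 p.234 + (2.51)–(2.55) p.232 + (2.66) p.234; Balaban1985Variational, (135) p.298] -/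
theorem thm34_Cinv_final [Fintype S] [DecidableEq S] [DecidableEq ι] [DecidableEq g.Site] [Nonempty g.Site] (blk : S → g.Site) (d : ℕ)
    (δ₀ κQ BG B₁ cF Cq a₀ d₀ M₂ : ℝ)
    (kQ : g.Site → S → 𝔸 →L[ℝ] 𝔸) (sQ : S → 𝔸 →L[ℝ] 𝔸) (cfun w : g.Site → ℝ)
    (hκQ : 0 < κQ) (hBG : 0 < BG) (hB₁ : 0 < B₁) (hcF : 0 < cF) (hCq : 0 ≤ Cq) (ha₀ : 0 ≤ a₀) (hM₂ : 0 ≤ M₂) (hδ₀ : 0 < δ₀)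
    -- the multiscale geometry 𝔅 (p. 393, [4] (2.1)–(2.4)) and its axioms
    (hdnn : ∀ a a' : g.Site, 0 ≤ g.dist a a') (htri : Triangle254 (toB6 g Rr H)) (hrefl : ∀ y : g.Site, g.dist y y = 0)
    (hsym : ∀ y y' : g.Site, g.dist y y' = g.dist y' y) (hlen : ∀ y : g.Site, 0 < g.len y) (hlenη : ∀ y : g.Site, g.eta ≤ g.len y)
    (hη : 0 < g.eta)
    -- [4] Lemma 2.1 (2.61) at the rate `δ₀`, «for every 0 < α < 1», and the p. 398 scale transfer for every exponent
    (h261 : ∀ α : ℝ, 0 < α → α < 1 → Ineq261 d (toB6 g Rr H) δ₀ α)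
    (hST : ∀ α : ℝ, 0 < α → ∃ Λ : ℝ, 1 ≤ Λ ∧ ScaleTransfer g δ₀ α Λ (fun a => g.len a) ∧ ScaleTransfer g δ₀ α Λ (fun a => g.len a ^ 2) ∧
      ScaleTransfer g δ₀ α Λ (fun a => (g.len a)⁻¹) ∧ ScaleTransfer g δ₀ α Λ (fun a => (g.len a ^ 2)⁻¹) ∧
      ScaleTransfer g δ₀ α Λ (fun a => (g.len a ^ 4)⁻¹) ∧ ScaleTransfer g δ₀ α Λ (fun y => g.len y ^ (-(4 : ℝ))))
    (hrepr : ∀ (v : 𝔸) (i : ι), |b.repr v i| ≤ M₂ * ‖v‖)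
    (hU1 : ∀ m z, ‖((U m z : 𝔸ˣ) : 𝔸)‖ ≤ 1 ∧ ‖(((U m z)⁻¹ : 𝔸ˣ) : 𝔸)‖ ≤ 1)
    (hd₀B : ∀ μ x, g.dist (blk x) (blk ((T μ).symm x)) ≤ d₀) (hd₀F : ∀ μ x, g.dist (blk x) (blk (T μ x)) ≤ d₀)
    (hd₀0 : ∀ y : g.Site, g.dist y y ≤ d₀)
    -- the `A`-independent data of the concrete `V′(A)` of (3.60)
    (hw : ∀ y, 0 ≤ w y) (hcard : ∀ y, ((B9Eq360Vprime.block blk y).card : ℝ) * w y ≤ 1)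
    (hkQ : ∀ y x, blk x = y → ‖kQ y x‖ ≤ w y) (hsQ : ∀ x, ‖sQ x‖ ≤ 1) (hcfun : ∀ y, |cfun y| ≤ a₀ * (g.len y ^ 2)⁻¹)
    -- THEOREM 3.1 for `G′(U)`: (3.42)₁,₂ at the rate `δ₀`
    {Gp : Module.End ℝ (S × ι → ℝ)}
    (h342_1 : HasMajorant (g := toB6 g Rr H) (fun p : S × ι => blk p.1) Gp
      (fun a a' => BG * g.len a ^ 2 * Real.exp (-(δ₀ * g.dist a a'))))
    (h342_2 : ∀ k : κ ⊕ κ, HasMajorant (g := toB6 g Rr H) (fun p : S × ι => blk p.1)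
      (conj b (diffLetter T U ((g.eta : ℂ)⁻¹) k) * Gp) (fun a a' => BG * g.len a * Real.exp (-(δ₀ * g.dist a a'))))
    -- the (3.19) letters `Q′(U)`, `Q′*(U)` in their own typing with block-local two-space majorants, a section of the block map (FILE 17)
    {Qc : (S × ι → ℝ) →ₗ[ℝ] (g.Site → ℝ)} {Qcs : (g.Site → ℝ) →ₗ[ℝ] (S × ι → ℝ)} {Linv : Module.End ℝ (g.Site → ℝ)}
    (hQc : HasMajorantHom (g := toB6 g Rr H) (fun p : S × ι => blk p.1) (fun y : g.Site => y) Qc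
      (fun a a' : g.Site => κQ * (if a = a' then (1 : ℝ) else 0)))
    (hQcs : HasMajorantHom (g := toB6 g Rr H) (fun y : g.Site => y) (fun p : S × ι => blk p.1) Qcs
      (fun a a' : g.Site => κQ * (if a = a' then (1 : ℝ) else 0)))
    -- THEOREM 3.2 for `U`: (3.21) `C⁻¹ = (Q′G′²Q′*)⁻¹` exists (`hLinv`) with the KERNEL bound (3.48) at the rate `δ₀`
    (hLinv : (Qc ∘ₗ (Gp * Gp) ∘ₗ Qcs) * Linv = 1)
    (h348 : ∀ y y' : g.Site, |B9Thm34Inv.ker (B9Thm34Inv.vol g d) Linv y y'| ≤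
      B₁ * g.len y ^ (-(4 : ℝ)) * g.len y' ^ (-(d : ℝ)) * Real.exp (-(δ₀ * g.dist y y'))) :
    ∃ a₁ : ℝ, 0 < a₁ ∧
    ∀ (α₁ : ℝ), 0 ≤ α₁ → α₁ ≤ a₁ →
    ∀ (A : κ → S → 𝔸) (kF : g.Site → S → 𝔸 →L[ℝ] 𝔸) (sF : S → 𝔸 →L[ℝ] 𝔸),
      (∀ y x, blk x = y → ‖kF y x‖ ≤ Cq * α₁ * w y) → (∀ x, ‖sF x‖ ≤ Cq * α₁) →
      (∀ ν k x, ‖((g.eta : ℂ)⁻¹) • covDstar T U ν (A k) x‖ ≤ α₁ * (g.len (blk x) ^ 2)⁻¹) →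
      (∀ k x, ‖A k x‖ ≤ α₁ * (g.len (blk x))⁻¹) → (∀ ν k x, ‖tauB T U ν (A k) x‖ ≤ α₁ * (g.len (blk x))⁻¹) →
    ∀ {Qc' Fc : (S × ι → ℝ) →ₗ[ℝ] (g.Site → ℝ)} {Qcs' Fcs : (g.Site → ℝ) →ₗ[ℝ] (S × ι → ℝ)},
      Qc' = Qc + Fc → Qcs' = Qcs + Fcs →
      HasMajorantHom (g := toB6 g Rr H) (fun p : S × ι => blk p.1) (fun y : g.Site => y) Fc
        (fun a a' : g.Site => cF * α₁ * (if a = a' then (1 : ℝ) else 0)) →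
      HasMajorantHom (g := toB6 g Rr H) (fun y : g.Site => y) (fun p : S × ι => blk p.1) Fcs
        (fun a a' : g.Site => cF * α₁ * (if a = a' then (1 : ℝ) else 0)) →
    ∃ Tinv : Module.End ℝ (g.Site → ℝ),
      Tinv * (Qc' ∘ₗ ((gPrimeExtEnd Gp (conj b (vPrimeConc T U g.eta A blk kQ kF sQ sF cfun) * Gp)) * (gPrimeExtEnd Gp (conj b (vPrimeConc T U g.eta A blk kQ kF sQ sF cfun) * Gp))) ∘ₗ Qcs') = 1 ∧
      (Qc' ∘ₗ ((gPrimeExtEnd Gp (conj b (vPrimeConc T U g.eta A blk kQ kF sQ sF cfun) * Gp)) * (gPrimeExtEnd Gp (conj b (vPrimeConc T U g.eta A blk kQ kF sQ sF cfun) * Gp))) ∘ₗ Qcs') * Tinv = 1 ∧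
      ∀ y y' : g.Site, |B9Thm34Inv.ker (B9Thm34Inv.vol g d) Tinv y y'| ≤
        2 * B₁ * B6.c1 d (2 / 5 * δ₀) (1 / 10) * g.len y ^ (-(4 : ℝ)) * g.len y' ^ (-(d : ℝ)) * Real.exp (-(9 / 25 * δ₀ * g.dist y y')) := by
  classical
  obtain ⟨y₀⟩ := ‹Nonempty g.Site›
  have hSb : 0 ≤ ∑ i, ‖b i‖ := Finset.sum_nonneg fun i _ => norm_nonneg _
  -- the p. 398 scale transfers and [4] Lemma 2.1 at the pairs of the `C⁻¹(U′U)`-chain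
  obtain ⟨Λ, hΛ, hT1, hT2, -, -, -, -⟩ := hST (1 / 100) (by norm_num)
  obtain ⟨c₄, hc₄1, -, -, -, -, -, hT4v⟩ := hST (1 / 10) (by norm_num)
  have hΛ0 : 0 < Λ := zero_lt_one.trans_le hΛ
  have hc₄ : 0 < c₄ := zero_lt_one.trans_le hc₄1
  have h261β : Ineq261 d (toB6 g Rr H) δ₀ (1 / 100) := h261 _ (by norm_num) (by norm_num)
  have h261c : Ineq261 d (toB6 g Rr H) (49 / 50 * δ₀) (1 / 100) :=
    ineq261_rescale (h261 (1 / 100 * (49 / 50)) (by norm_num) (by norm_num))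
  have h261v : Ineq261 d (toB6 g Rr H) δ₀ (1 / 2 + 1 / 10) := h261 _ (by norm_num) (by norm_num)
  have h261v' : Ineq261 d (toB6 g Rr H) ((1 / 2 - 1 / 10) * δ₀) (1 / 10) :=
    ineq261_rescale (h261 (1 / 10 * (1 / 2 - 1 / 10)) (by norm_num) (by norm_num))
  have hc₂ : 0 < B6.c1 d δ₀ (1 / 100) := c1_pos_of_ineq261 h261β y₀ (hrefl y₀)
  have hcc' : 0 < B6.c1 d (49 / 50 * δ₀) (1 / 100) := c1_pos_of_ineq261 h261c y₀ (hrefl y₀)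
  have hc₁v : 0 < B6.c1 d δ₀ (1 / 2 + 1 / 10) := c1_pos_of_ineq261 h261v y₀ (hrefl y₀)
  have hc₁v' : 0 < B6.c1 d ((1 / 2 - 1 / 10) * δ₀) (1 / 10) := c1_pos_of_ineq261 h261v' y₀ (hrefl y₀)
  have hrc1 : 49 / 50 * δ₀ + (1 / 100 + 1 / 100) * δ₀ ≤ δ₀ := by linarith only [hδ₀]
  have hrc : δ₀ / 2 + (1 / 100 + 1 / 100) * δ₀ ≤ (1 - 1 / 100) * (49 / 50 * δ₀) := by linarith only [hδ₀]
  have hρc0 : 0 ≤ 49 / 50 * δ₀ := by linarith only [hδ₀]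
  -- «for α₁ sufficiently small» (p. 403): the two threshold functions of the chain are continuous at `α₁ = 0` and vanish there
  obtain ⟨ε₁, hε₁, hF1⟩ := exists_threshold_of_continuousAt
    (f := fun α₁ : ℝ => theta363 (Fintype.card κ) 1 α₁ a₀ Cq M₂ (∑ i, ‖b i‖) (Real.exp (δ₀ * d₀)) BG Λ (B6.c1 d δ₀ (1 / 100)) * B6.c1 d (49 / 50 * δ₀) (1 / 100))
    (by unfold theta363 kappa385 cVConc cBConc; fun_prop) (by simp [theta363])
  obtain ⟨ε₅, hε₅, hF5⟩ := exists_threshold_of_continuousAt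
    (f := fun α₁ : ℝ => α₁ * (2 * (kappa366 κQ cF (kappa385 1 (cVConc (Fintype.card κ) 1 α₁ a₀ Cq M₂ (∑ i, ‖b i‖) (Real.exp (δ₀ * d₀))) 0 0 Λ (B6.c1 d δ₀ (1 / 100))) BG (BG * B6.c1 d (49 / 50 * δ₀) (1 / 100) * (1 - theta363 (Fintype.card κ) 1 α₁ a₀ Cq M₂ (∑ i, ‖b i‖) (Real.exp (δ₀ * d₀)) BG Λ (B6.c1 d δ₀ (1 / 100)) * B6.c1 d (49 / 50 * δ₀) (1 / 100))⁻¹) Λ (B6.c1 d δ₀ (1 / 100)) α₁ * B₁ * c₄ * B6.c1 d δ₀ (1 / 2 + 1 / 10)) * B6.c1 d ((1 / 2 - 1 / 10) * δ₀) (1 / 10)))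
    (by
      unfold theta363 kappa366 kappa385 cVConc cBConc
      fun_prop (disch := simp))
    (by simp)
  refine ⟨min (min ε₁ ε₅) (1 / 2) / 2, half_pos (lt_min (lt_min hε₁ hε₅) one_half_pos), ?_⟩
  intro α₁ hα₁0 hα₁1 A kF sF hkF hsF h337B hA hAτB Qc' Fc Qcs' Fcs h357 h357s hFc hFcs
  have hmε₁ : min (min ε₁ ε₅) (1 / 2) ≤ ε₁ := (min_le_left _ _).trans (min_le_left _ _)
  have hmε₅ : min (min ε₁ ε₅) (1 / 2) ≤ ε₅ := (min_le_left _ _).trans (min_le_right _ _)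
  have hmh : min (min ε₁ ε₅) (1 / 2) ≤ 1 / 2 := min_le_right _ _
  have habs : |α₁| = α₁ := abs_of_nonneg hα₁0
  have h1 : theta363 (Fintype.card κ) 1 α₁ a₀ Cq M₂ (∑ i, ‖b i‖) (Real.exp (δ₀ * d₀)) BG Λ (B6.c1 d δ₀ (1 / 100)) * B6.c1 d (49 / 50 * δ₀) (1 / 100) < 1 / 2 := hF1 α₁ (by rw [habs]; linarith only [hα₁1, hmε₁, hε₁])
  have h5 : α₁ * (2 * (kappa366 κQ cF (kappa385 1 (cVConc (Fintype.card κ) 1 α₁ a₀ Cq M₂ (∑ i, ‖b i‖) (Real.exp (δ₀ * d₀))) 0 0 Λ (B6.c1 d δ₀ (1 / 100))) BG (BG * B6.c1 d (49 / 50 * δ₀) (1 / 100) * (1 - theta363 (Fintype.card κ) 1 α₁ a₀ Cq M₂ (∑ i, ‖b i‖) (Real.exp (δ₀ * d₀)) BG Λ (B6.c1 d δ₀ (1 / 100)) * B6.c1 d (49 / 50 * δ₀) (1 / 100))⁻¹) Λ (B6.c1 d δ₀ (1 / 100)) α₁ * B₁ * c₄ * B6.c1 d δ₀ (1 / 2 +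 1 / 10)) * B6.c1 d ((1 / 2 - 1 / 10) * δ₀) (1 / 10)) < 1 / 2 :=
    hF5 α₁ (by rw [habs]; linarith only [hα₁1, hmε₅, hε₅])
  have hhalf : (1 / 2 : ℝ) < 1 := by norm_num
  -- `η·α₁(Lʲη)⁻¹ ≦ 1/4` from `α₁ ≦ 1/4` and `η ≦ Lʲη`
  have hsmall : ∀ y : g.Site, g.eta * (α₁ * (g.len y)⁻¹) ≤ 1 / 4 := fun y => by
    have hq : g.eta * (g.len y)⁻¹ ≤ 1 := by
      rw [← div_eq_mul_inv]; exact (div_le_one (hlen y)).mpr (hlenη y)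
    calc g.eta * (α₁ * (g.len y)⁻¹) = α₁ * (g.eta * (g.len y)⁻¹) := by ring
      _ ≤ α₁ * 1 := mul_le_mul_of_nonneg_left hq hα₁0
      _ ≤ 1 / 4 := by linarith only [hα₁1, hmh]
  -- signs of the explicit constants at this `α₁`, and the explicit threshold `ha₁'`
  have hcV0E : ∀ E : ℝ, 0 ≤ E →
      0 ≤ kappa385 1 (cVConc (Fintype.card κ) 1 α₁ a₀ Cq M₂ (∑ i, ‖b i‖) E) 0 0 Λ (B6.c1 d δ₀ (1 / 100)) := fun E hE =>
    kappa385_nonneg zero_le_one (cVConc_nonneg hα₁0 ha₀ hCq hM₂ hSb hE) le_rfl le_rfl hΛ0.le hc₂.le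
  have hNc : 0 < BG * B6.c1 d (49 / 50 * δ₀) (1 / 100) * (1 - theta363 (Fintype.card κ) 1 α₁ a₀ Cq M₂ (∑ i, ‖b i‖) (Real.exp (δ₀ * d₀)) BG Λ (B6.c1 d δ₀ (1 / 100)) * B6.c1 d (49 / 50 * δ₀) (1 / 100))⁻¹ :=
    mul_pos (mul_pos hBG hcc') (inv_pos.mpr (by linarith only [h1]))
  have hκC0 : 0 < kappa366 κQ cF (kappa385 1 (cVConc (Fintype.card κ) 1 α₁ a₀ Cq M₂ (∑ i, ‖b i‖) (Real.exp (δ₀ * d₀))) 0 0 Λ (B6.c1 d δ₀ (1 / 100))) BG (BG * B6.c1 d (49 / 50 * δ₀) (1 / 100) * (1 - theta363 (Fintype.card κ) 1 α₁ a₀ Cq M₂ (∑ i, ‖b i‖) (Real.exp (δ₀ * d₀)) BG Λ (B6.c1 d δ₀ (1 / 100)) * B6.c1 d (49 / 50 * δ₀) (1 / 100))⁻¹) Λ (B6.c1 d δ₀ (1 / 100)) α₁ :=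
    kappa366_pos hκQ hcF (hcV0E _ (Real.exp_nonneg _)) hNc hΛ0 hc₂ hα₁0
  have hXpos : 0 < 2 * (kappa366 κQ cF (kappa385 1 (cVConc (Fintype.card κ) 1 α₁ a₀ Cq M₂ (∑ i, ‖b i‖) (Real.exp (δ₀ * d₀))) 0 0 Λ (B6.c1 d δ₀ (1 / 100))) BG (BG * B6.c1 d (49 / 50 * δ₀) (1 / 100) * (1 - theta363 (Fintype.card κ) 1 α₁ a₀ Cq M₂ (∑ i, ‖b i‖) (Real.exp (δ₀ * d₀)) BG Λ (B6.c1 d δ₀ (1 / 100)) * B6.c1 d (49 / 50 * δ₀) (1 / 100))⁻¹) Λ (B6.c1 d δ₀ (1 / 100)) α₁ * B₁ * c₄ * B6.c1 d δ₀ (1 / 2 + 1 / 10)) * B6.c1 d ((1 / 2 - 1 / 10) * δ₀) (1 / 10) :=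
    mul_pos (mul_pos two_pos (mul_pos (mul_pos (mul_pos hκC0 hB₁) hc₄) hc₁v)) hc₁v'
  have ha₁' : α₁ ≤ (2 * (kappa366 κQ cF (kappa385 1 (cVConc (Fintype.card κ) 1 α₁ a₀ Cq M₂ (∑ i, ‖b i‖) (Real.exp (δ₀ * d₀))) 0 0 Λ (B6.c1 d δ₀ (1 / 100))) BG (BG * B6.c1 d (49 / 50 * δ₀) (1 / 100) * (1 - theta363 (Fintype.card κ) 1 α₁ a₀ Cq M₂ (∑ i, ‖b i‖) (Real.exp (δ₀ * d₀)) BG Λ (B6.c1 d δ₀ (1 / 100)) * B6.c1 d (49 / 50 * δ₀) (1 / 100))⁻¹) Λ (B6.c1 d δ₀ (1 / 100)) α₁ * B₁ * c₄ * B6.c1 d δ₀ (1 / 2 + 1 / 10)) * B6.c1 d ((1 / 2 - 1 / 10) * δ₀) (1 / 10))⁻¹ := by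
    rw [inv_eq_one_div, le_div_iff₀ hXpos]; linarith only [h5]
  -- the shapes gen 9's `B9Ineq366Vprime` reads (3.37) / the stencil geometry in
  have hA' : ∀ μ x, ‖A μ x‖ ≤ α₁ * (g.len (blk x))⁻¹ ∧ ‖tauB T U μ (A μ) x‖ ≤ α₁ * (g.len (blk x))⁻¹ :=
    fun μ x => ⟨hA μ x, hAτB μ μ x⟩
  have h337s' : ∀ μ x, ‖((g.eta : ℂ)⁻¹) • covDstar T U μ (A μ) x‖ ≤ α₁ * (g.len (blk x) ^ 2)⁻¹ := fun μ x => h337B μ μ x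
  have hd₀' : ∀ μ x, g.dist (blk x) (blk (T μ x)) ≤ d₀ ∧ g.dist (blk x) (blk ((T μ).symm x)) ≤ d₀ :=
    fun μ x => ⟨hd₀F μ x, hd₀B μ x⟩
  -- «The inverse satisfies Theorem 3.2» (gen 9)
  obtain ⟨Tinv, hTl, hTr, hTker⟩ := inverse_satisfies_thm32_vPrime (Rr := Rr) (H := H) b T U blk d hη A kQ kF sQ sF cfun w 1 d₀ M₂ Cq a₀
    δ₀ δ₀ (1 / 100) (1 / 100) (49 / 50 * δ₀) Λ BG α₁ (1 / 100) κQ cF (1 / 10) (1 / 10) c₄ B₁ hBG hα₁0 hΛ0 hρc0 (by norm_num) (by norm_num)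
    hδ₀ hδ₀.le hκQ hcF (by norm_num) (by norm_num) (by norm_num) hc₄ hB₁ hrc1 (by norm_num) (by norm_num) hrc hc₁v hc₁v' hc₂ hcc' hdnn
    hrefl hsym htri hlen h261β h261c h261v h261v' hT1 hT2 hT4v hM₂ hrepr hsmall hA' h337s' hU1 hd₀' hd₀0 hw hcard hCq ha₀ hkQ hkF hsQ
    hsF hcfun (h1.trans hhalf) h342_1 h342_2 h357 h357s hQc hQcs hFc hFcs hLinv h348 ha₁'
  refine ⟨Tinv, hTl, hTr, fun y y' => ?_⟩
  have h := hTker y y'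
  have e1 : B6.c1 d ((1 / 2 - 1 / 10) * δ₀) (1 / 10) = B6.c1 d (2 / 5 * δ₀) (1 / 10) := by norm_num
  have e2 : Real.exp (-((1 - 1 / 10) * ((1 / 2 - 1 / 10) * δ₀) * g.dist y y')) = Real.exp (-(9 / 25 * δ₀ * g.dist y y')) := by
    congr 1; ring
  rw [e1, e2] at h
  exact h

end CInv

/-! ## §3  Theorem 3.4, the Sect. B step for the three operator families together -/

section SectB

variable {𝔸 : Type*} [NormedRing 𝔸] [NormedAlgebra ℂ 𝔸] [CompleteSpace 𝔸] {ι : Type} [Fintype ι]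
variable (b : Module.Basis ι ℝ 𝔸) {S : Type} {κ : Type} [Fintype κ] [LinearOrder κ]
variable (T : κ → Equiv.Perm S) (U : κ → S → 𝔸ˣ)
variable {g : B9.Geometry} [Fintype g.Site] {Rr : ℝ} {H : Prop}

set_option maxHeartbeats 1600000 in
/-- **THEOREM 3.4 — THE SECT. B STEP FOR `G′(U′U)`, `(Q′G′²Q′*)⁻¹(U′U)` AND `G(U′U)` TOGETHER, PRINTED QUANTIFIERS** («There exists a positive constant a₁ such that the operators G′(U), (Q′(U)G′²(U)Q′*(U))⁻¹, R(U), G(U) extend to configurations U′U for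
α₁ ≦ a₁ as analytic functions of A. The extended operators satisfy all the inequalities of Theorems 3.1–3.3 correspondingly», p. 400; «of course with different constants», p. 403), for the sup/kernel members: hypotheses = FILE 24/25's (`thm34_G_kernelEntriesAll` /
`thm34_G_kernel_final`: Theorems 3.1/3.2/3.3 FOR `U` at `δ₀` in block-majorant form and, for (3.48) and Theorem 3.3's (3.42)₁₋₄, in kernel form;
[4] Lemma 2.1 and the p. 398 scale transfer for every exponent; real coordinates; commuting translations; (3.35) through each bond; stencil geometry;
the `A`-free (3.19)/(3.24)/(3.60) data; the (3.15) bond letters) PLUS the letter `Δ′_a(U)` with `Δ′_a(U)G′(U) = G′(U)Δ′_a(U) = 1` ((3.24)).  CONCLUSION: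
`∃ a₁ > 0 ∃ B ≧ 0 ∀ α₁ ≦ a₁ ∀ A` in (3.37) (blockwise) `∀ kF sF ∀` (3.57)/(3.59) letters `∀` (3.80)–(3.81) letters: (i) `G′(U′U) = gPrimeExtEnd G′(U) (V′(A)G′(U))`
is the two-sided inverse of `Δ′_a(U) − V′(A)` and every left/right (3.42)-entry of Theorem 3.1 transfers at `(B, 9δ₀/10)`; (ii) ∃ `C⁻¹(U′U)` two-sided
inverse of `Q′(U′U)G′²(U′U)Q′*(U′U)` with `|C⁻¹(U′U)(y,y′)| ≦ B(Lʲη)⁻⁴(L^{j′}η)^{−d}e^{−(9δ₀/25)d}` ((3.48)); (iii) ∃ `G(U′U)` two-sided inverse of the concrete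
`Δ_a(U′U)` (whose `P′(A)` carries THIS `C⁻¹(U′U)`) with every left/right (3.42)-entry of Theorem 3.3 at `(B, δ₀/6)` and all four entries in the
printed kernel form at `(B, δ₀/10)` — ONE `a₁`, ONE `B`.  PROOF: §1, §2, FILE 25 `thm34_G_kernel_final`; the `C⁻¹(U′U)` of §2 and of FILE 25 agree
(Mathlib `left_inv_eq_right_inv`).
[cite: Balaban1985BackgroundPropagators, Thm 3.4 p.400 + p.402 + p.403 + p.407 + Thm 3.1 (3.42) p.397 + Thm 3.2 (3.48) p.398 + Thm 3.3 p.399 + (3.24)/(3.25) p.394 + (3.60)–(3.67) pp.402–403 + (3.84)–(3.86) p.407 + (3.76)–(3.77) pp.405–406 + (3.35)/(3.37) p.396; Balaban1984PropagatorsII, Lemma 2.1 p.234 + (2.51)–(2.55) p.232 + (2.66) p.234; Balaban1985Variational, (135) p.298] -/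
theorem thm34_sectB_final [Fintype S] [DecidableEq S] [DecidableEq ι] [DecidableEq g.Site] [Nonempty g.Site] (blk : S → g.Site) (d : ℕ)
    (δ₀ B₀ κQ BG B₁ cF Cq a₀ C₀ d₀ M₂ κQb cFb abar : ℝ)
    (kQ : g.Site → S → 𝔸 →L[ℝ] 𝔸) (sQ : S → 𝔸 →L[ℝ] 𝔸) (cfun w : g.Site → ℝ)
    (hB₀ : 0 ≤ B₀) (hκQ : 0 < κQ) (hBG : 0 < BG) (hB₁ : 0 < B₁) (hcF : 0 < cF) (hCq : 0 ≤ Cq) (ha₀ : 0 ≤ a₀) (hC₀ : 0 ≤ C₀)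
    (hM₂ : 0 ≤ M₂) (hδ₀ : 0 < δ₀) (hκQb : 0 ≤ κQb) (hcFb : 0 ≤ cFb) (habar : 0 ≤ abar)
    -- the multiscale geometry 𝔅 (p. 393, [4] (2.1)–(2.4)) and its axioms
    (hdnn : ∀ a a' : g.Site, 0 ≤ g.dist a a') (htri : Triangle254 (toB6 g Rr H)) (hrefl : ∀ y : g.Site, g.dist y y = 0)
    (hsym : ∀ y y' : g.Site, g.dist y y' = g.dist y' y) (hlen : ∀ y : g.Site, 0 < g.len y) (hlenη : ∀ y : g.Site, g.eta ≤ g.len y)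
    (hη : 0 < g.eta) (hL : 1 ≤ g.L)
    -- [4] Lemma 2.1 (2.61) at the rate `δ₀`, «for every 0 < α < 1»
    (h261 : ∀ α : ℝ, 0 < α → α < 1 → Ineq261 d (toB6 g Rr H) δ₀ α)
    -- p. 398: «Using Lemma 2.1 in [4] we may replace the factor (Lʲη)^α by (Lʲη)^β(L^{j′}η)^γ with β + γ = α» — for every exponent, one
    -- constant `Λ(α) ≧ 1` for the six weights `(Lʲη)^{1,2,−1,−2,−4}` (natural and real powers)
    (hST : ∀ α : ℝ, 0 < α → ∃ Λ : ℝ, 1 ≤ Λ ∧ ScaleTransfer g δ₀ α Λ (fun a => g.len a) ∧ ScaleTransfer g δ₀ α Λ (fun a => g.len a ^ 2) ∧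
      ScaleTransfer g δ₀ α Λ (fun a => (g.len a)⁻¹) ∧ ScaleTransfer g δ₀ α Λ (fun a => (g.len a ^ 2)⁻¹) ∧
      ScaleTransfer g δ₀ α Λ (fun a => (g.len a ^ 4)⁻¹) ∧ ScaleTransfer g δ₀ α Λ (fun y => g.len y ^ (-(4 : ℝ))))
    -- real coordinates of `𝔸`, commuting translations, unitary-type background
    (hrepr : ∀ (v : 𝔸) (i : ι), |b.repr v i| ≤ M₂ * ‖v‖) (hT : ∀ (μ ν : κ) (x : S), T μ (T ν x) = T ν (T μ x))
    (hU1 : ∀ m z, ‖((U m z : 𝔸ˣ) : 𝔸)‖ ≤ 1 ∧ ‖(((U m z)⁻¹ : 𝔸ˣ) : 𝔸)‖ ≤ 1)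
    -- (3.35) on the plaquettes through each bond, at that bond's block scale; stencil geometry at range `d₀`
    (h35 : ∀ μ x m n y, Through T μ x m n y → ‖(plaqU T U m n y : 𝔸) - 1‖ ≤ C₀ * ((g.L ^ g.scale (blk x))⁻¹) ^ 2)
    (hd₀B : ∀ μ x, g.dist (blk x) (blk ((T μ).symm x)) ≤ d₀) (hd₀F : ∀ μ x, g.dist (blk x) (blk (T μ x)) ≤ d₀)
    (hd₀FB : ∀ μ ν x, g.dist (blk x) (blk ((T ν).symm (T μ x))) ≤ d₀)
    (hd₀st : ∀ μ x (q : κ × S), q ∈ stBonds T μ x → g.dist (blk x) (blk q.2) ≤ d₀)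
    (hd₀loc : ∀ μ x (q : κ × S), q ∈ B9Eq375Locality.locBondsA' T μ x → g.dist (blk x) (blk q.2) ≤ d₀)
    (hd₀0 : ∀ y : g.Site, g.dist y y ≤ d₀)
    -- the `A`-independent data of the concrete `V′(A)` of (3.60): (3.19) kernels/multipliers and the `a`-weights of (3.24)
    (hw : ∀ y, 0 ≤ w y) (hcard : ∀ y, ((B9Eq360Vprime.block blk y).card : ℝ) * w y ≤ 1)
    (hkQ : ∀ y x, blk x = y → ‖kQ y x‖ ≤ w y) (hsQ : ∀ x, ‖sQ x‖ ≤ 1) (hcfun : ∀ y, |cfun y| ≤ a₀ * (g.len y ^ 2)⁻¹)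
    -- THEOREM 3.1 for `G′(U)`: (3.42)₁,₂,₃ at the rate `δ₀`
    {Gp : Module.End ℝ (S × ι → ℝ)}
    (h342_1 : HasMajorant (g := toB6 g Rr H) (fun p : S × ι => blk p.1) Gp
      (fun a a' => BG * g.len a ^ 2 * Real.exp (-(δ₀ * g.dist a a'))))
    (h342_2 : ∀ k : κ ⊕ κ, HasMajorant (g := toB6 g Rr H) (fun p : S × ι => blk p.1)
      (conj b (diffLetter T U ((g.eta : ℂ)⁻¹) k) * Gp) (fun a a' => BG * g.len a * Real.exp (-(δ₀ * g.dist a a'))))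
    (h342_3 : ∀ k : κ ⊕ κ, HasMajorant (g := toB6 g Rr H) (fun p : S × ι => blk p.1)
      (Gp * conj b (diffLetter T U ((g.eta : ℂ)⁻¹) k)) (fun a a' => BG * g.len a * Real.exp (-(δ₀ * g.dist a a'))))
    -- (3.24): `G′(U) = (Δ′_a(U))⁻¹` for the letter `Δ′_a(U)`
    {Δp : Module.End ℝ (S × ι → ℝ)} (hΔpGp : Δp * Gp = 1) (hGpΔp : Gp * Δp = 1)
    -- the (3.19) letters `Q′(U)`, `Q′*(U)` in their own typing with block-local two-space majorants, a section of the block map (FILE 17)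
    (rep : g.Site → S × ι) (hrep : ∀ y : g.Site, blk (rep y).1 = y)
    {Qc : (S × ι → ℝ) →ₗ[ℝ] (g.Site → ℝ)} {Qcs : (g.Site → ℝ) →ₗ[ℝ] (S × ι → ℝ)} {Linv : Module.End ℝ (g.Site → ℝ)}
    (hQc : HasMajorantHom (g := toB6 g Rr H) (fun p : S × ι => blk p.1) (fun y : g.Site => y) Qc
      (fun a a' : g.Site => κQ * (if a = a' then (1 : ℝ) else 0)))
    (hQcs : HasMajorantHom (g := toB6 g Rr H) (fun y : g.Site => y) (fun p : S × ι => blk p.1) Qcs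
      (fun a a' : g.Site => κQ * (if a = a' then (1 : ℝ) else 0)))
    -- THEOREM 3.2 for `U`: (3.21) `C⁻¹ = (Q′G′²Q′*)⁻¹` exists (`hLinv`) with the KERNEL bound (3.48) at the rate `δ₀`
    (hLinv : (Qc ∘ₗ (Gp * Gp) ∘ₗ Qcs) * Linv = 1)
    (h348 : ∀ y y' : g.Site, |B9Thm34Inv.ker (B9Thm34Inv.vol g d) Linv y y'| ≤
      B₁ * g.len y ^ (-(4 : ℝ)) * g.len y' ^ (-(d : ℝ)) * Real.exp (-(δ₀ * g.dist y y')))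
    -- the (3.15) bond letters `Q(U)`, `Q*(U)` and the weight letter `a` of (3.24)/(3.26), with their majorants
    {G Qs Q a : Module.End ℝ ((κ × S) × ι → ℝ)}
    (hQb : HasMajorant (g := toB6 g Rr H) (fun q : (κ × S) × ι => blk q.1.2) Q (fun a a' => κQb * Real.exp (-(δ₀ * g.dist a a'))))
    (hQsb : HasMajorant (g := toB6 g Rr H) (fun q : (κ × S) × ι => blk q.1.2) Qs (fun a a' => κQb * Real.exp (-(δ₀ * g.dist a a'))))
    (ha324 : HasMajorant (g := toB6 g Rr H) (fun q : (κ × S) × ι => blk q.1.2) a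
      (fun a a' : g.Site => if a = a' then abar * (g.len a ^ 2)⁻¹ else 0))
    -- THEOREM 3.3 for `G(U)`: two-sided inverse of the concrete `Δ_a(U)` and its (3.42)-entries at the rate `δ₀`
    (hΔG : deltaA (conj b (lapDDLetter T ((g.eta : ℂ)⁻¹) U)) (conj b (dPrimeLetter T U g.eta))
      (conjHom b (gradLin T ((g.eta : ℂ)⁻¹) U) ∘ₗ (1 - (Gp ∘ₗ Qcs ∘ₗ Linv ∘ₗ Qc ∘ₗ Gp)) ∘ₗ conjHom b (divLin T ((g.eta : ℂ)⁻¹) U)) Qs a Q * G = 1)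
    (hGΔ : G * deltaA (conj b (lapDDLetter T ((g.eta : ℂ)⁻¹) U)) (conj b (dPrimeLetter T U g.eta))
      (conjHom b (gradLin T ((g.eta : ℂ)⁻¹) U) ∘ₗ (1 - (Gp ∘ₗ Qcs ∘ₗ Linv ∘ₗ Qc ∘ₗ Gp)) ∘ₗ conjHom b (divLin T ((g.eta : ℂ)⁻¹) U)) Qs a Q = 1)
    (hG : HasMajorant (g := toB6 g Rr H) (fun q : (κ × S) × ι => blk q.1.2) G
      (fun a a' => B₀ * g.len a ^ 2 * Real.exp (-(δ₀ * g.dist a a'))))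
    (hDG : ∀ k : κ ⊕ κ, HasMajorant (g := toB6 g Rr H) (fun q : (κ × S) × ι => blk q.1.2)
      (conj b (diffLetter (bT T) (bU U) ((g.eta : ℂ)⁻¹) k) * G) (fun a a' => B₀ * g.len a * Real.exp (-(δ₀ * g.dist a a'))))
    (hGD : ∀ k : κ ⊕ κ, HasMajorant (g := toB6 g Rr H) (fun q : (κ × S) × ι => blk q.1.2)
      (G * conj b (diffLetter (bT T) (bU U) ((g.eta : ℂ)⁻¹) k)) (fun a a' => B₀ * g.len a * Real.exp (-(δ₀ * g.dist a a'))))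
    -- NEW (kernel form): Theorem 3.3's (3.42)₁,₂,₃,₄ for `G(U)` as PRINTED KERNEL BOUNDS (pairing weight `c = η^d`, volume weight `v(y′) = (L^j′ η)^d`)
    {v : g.Site → ℝ} (hv : ∀ y, 0 < v y) {c : ℝ} (hc : 0 < c)
    (hGk : HasKernelBound (g := toB6 g Rr H) (fun q : (κ × S) × ι => blk q.1.2) v c G
      (fun a a' => B₀ * g.len a ^ 2 * Real.exp (-(δ₀ * g.dist a a'))))
    (hDGk : ∀ k : κ ⊕ κ, HasKernelBound (g := toB6 g Rr H) (fun q : (κ × S) × ι => blk q.1.2) v c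
      (conj b (diffLetter (bT T) (bU U) ((g.eta : ℂ)⁻¹) k) * G) (fun a a' => B₀ * g.len a * Real.exp (-(δ₀ * g.dist a a'))))
    (hGDk : ∀ l : κ ⊕ κ, HasKernelBound (g := toB6 g Rr H) (fun q : (κ × S) × ι => blk q.1.2) v c
      (G * conj b (diffLetter (bT T) (bU U) ((g.eta : ℂ)⁻¹) l)) (fun a a' => B₀ * g.len a * Real.exp (-(δ₀ * g.dist a a'))))
    (hDGDk : ∀ k l : κ ⊕ κ, HasKernelBound (g := toB6 g Rr H) (fun q : (κ × S) × ι => blk q.1.2) v c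
      (conj b (diffLetter (bT T) (bU U) ((g.eta : ℂ)⁻¹) k) * G * conj b (diffLetter (bT T) (bU U) ((g.eta : ℂ)⁻¹) l)) (fun a a' => B₀ * Real.exp (-(δ₀ * g.dist a a')))) :
    ∃ a₁ : ℝ, 0 < a₁ ∧ ∃ B : ℝ, 0 ≤ B ∧
    ∀ (α₁ : ℝ), 0 ≤ α₁ → α₁ ≤ a₁ →
    -- the exponent field `A` in the domain (3.37), read blockwise in the shapes of FILES 1–19, and the `A`-dependent (3.59) data `kF`, `sF`
    ∀ (A : κ → S → 𝔸) (kF : g.Site → S → 𝔸 →L[ℝ] 𝔸) (sF : S → 𝔸 →L[ℝ] 𝔸),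
      (∀ y x, blk x = y → ‖kF y x‖ ≤ Cq * α₁ * w y) → (∀ x, ‖sF x‖ ≤ Cq * α₁) →
      (∀ ν k x, ‖((g.eta : ℂ)⁻¹) • covDstar T U ν (A k) x‖ ≤ α₁ * (g.len (blk x) ^ 2)⁻¹) →
      (∀ μ ν x, ‖((g.eta : ℂ)⁻¹) • covD T U μ (A ν) x‖ ≤ α₁ * (g.len (blk x) ^ 2)⁻¹) →
      (∀ μ ν x, ‖((g.eta : ℂ)⁻¹) • covDstar T U ν (A ν) (T μ x)‖ ≤ α₁ * (g.len (blk x) ^ 2)⁻¹) →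
      (∀ μ x, ‖((g.eta : ℂ)⁻¹) • covDstar T U μ (tauB T U μ (A μ)) x‖ ≤ α₁ * (g.len (blk x) ^ 2)⁻¹) →
      (∀ μ ν k x, ‖((g.eta : ℂ)⁻¹) • covD T U μ (A k) ((T ν).symm x)‖ ≤ α₁ * (g.len (blk x) ^ 2)⁻¹) →
      (∀ k x, ‖A k x‖ ≤ α₁ * (g.len (blk x))⁻¹) → (∀ ν k x, ‖tauB T U ν (A k) x‖ ≤ α₁ * (g.len (blk x))⁻¹) →
      (∀ μ k x, ‖tauF T U μ (A k) x‖ ≤ α₁ * (g.len (blk x))⁻¹) →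
      (∀ k μ ν x, ‖A k ((T ν).symm (T μ x))‖ ≤ α₁ * (g.len (blk x))⁻¹) →
      (∀ μ x m z, (m, z) ∈ stBonds T μ x → ‖A m z‖ ≤ α₁ * (g.len (blk x))⁻¹) →
      (∀ μ x m z, (m, z) ∈ B9Eq375Locality.locBondsA T μ x → ‖A m z‖ ≤ α₁ * (g.len (blk x))⁻¹) →
      (∀ μ x m n y, Through T μ x m n y →
        ‖covD T U m (A n) y‖ ≤ g.eta * (α₁ * ((g.len (blk x))⁻¹) ^ 2) ∧ ‖covD T U n (A m) y‖ ≤ g.eta * (α₁ * ((g.len (blk x))⁻¹) ^ 2)) →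
    -- the (3.57)/(3.59) letters `F′₂(A)`, `F′₂*(A)` (block-local, size `c_F α₁`)
    ∀ {Qc' Fc : (S × ι → ℝ) →ₗ[ℝ] (g.Site → ℝ)} {Qcs' Fcs : (g.Site → ℝ) →ₗ[ℝ] (S × ι → ℝ)},
      Qc' = Qc + Fc → Qcs' = Qcs + Fcs →
      HasMajorantHom (g := toB6 g Rr H) (fun p : S × ι => blk p.1) (fun y : g.Site => y) Fc
        (fun a a' : g.Site => cF * α₁ * (if a = a' then (1 : ℝ) else 0)) →
      HasMajorantHom (g := toB6 g Rr H) (fun y : g.Site => y) (fun p : S × ι => blk p.1) Fcs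
        (fun a a' : g.Site => cF * α₁ * (if a = a' then (1 : ℝ) else 0)) →
    -- the (3.80)–(3.81) letters `F₂(A)`, `F₂*(A)` («|F₂(A)|, |F₂*(A)| ≦ O(1)α₁»), `P₂(A)` of (3.82)
    ∀ {P₂ Qs' Q' F₂ F₂s : Module.End ℝ ((κ × S) × ι → ℝ)},
      Q' = Q + F₂ → Qs' = Qs + F₂s → P₂ = pTwo Qs Q F₂ F₂s a →
      HasMajorant (g := toB6 g Rr H) (fun q : (κ × S) × ι => blk q.1.2) F₂ (fun a a' => cFb * α₁ * Real.exp (-(δ₀ * g.dist a a'))) →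
      HasMajorant (g := toB6 g Rr H) (fun q : (κ × S) × ι => blk q.1.2) F₂s (fun a a' => cFb * α₁ * Real.exp (-(δ₀ * g.dist a a'))) →
      -- (i) THEOREM 3.4 FOR `G′(U′U) := G′(U)(I − V′(A)G′(U))⁻¹` ((3.64))
      (Δp - conj b (vPrimeConc T U g.eta A blk kQ kF sQ sF cfun)) * (gPrimeExtEnd Gp (conj b (vPrimeConc T U g.eta A blk kQ kF sQ sF cfun) * Gp)) = 1 ∧
      (gPrimeExtEnd Gp (conj b (vPrimeConc T U g.eta A blk kQ kF sQ sF cfun) * Gp)) * (Δp - conj b (vPrimeConc T U g.eta A blk kQ kF sQ sF cfun)) = 1 ∧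
      (∀ (X : Module.End ℝ (S × ι → ℝ)) (P : g.Site → ℝ), (∀ y, 0 ≤ P y) →
        HasMajorant (g := toB6 g Rr H) (fun p : S × ι => blk p.1) (X * Gp) (fun a a' => BG * P a * Real.exp (-(δ₀ * g.dist a a'))) →
        HasMajorant (g := toB6 g Rr H) (fun p : S × ι => blk p.1) (X * (gPrimeExtEnd Gp (conj b (vPrimeConc T U g.eta A blk kQ kF sQ sF cfun) * Gp)))
          (fun a a' => B * P a * Real.exp (-(9 / 10 * δ₀ * g.dist a a')))) ∧
      (∀ Y : Module.End ℝ (S × ι → ℝ),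
        HasMajorant (g := toB6 g Rr H) (fun p : S × ι => blk p.1) (Gp * Y) (fun a a' => BG * g.len a * Real.exp (-(δ₀ * g.dist a a'))) →
        HasMajorant (g := toB6 g Rr H) (fun p : S × ι => blk p.1) ((gPrimeExtEnd Gp (conj b (vPrimeConc T U g.eta A blk kQ kF sQ sF cfun) * Gp)) * Y)
          (fun a a' => B * g.len a * Real.exp (-(9 / 10 * δ₀ * g.dist a a')))) ∧
    ∃ (Tinv : Module.End ℝ (g.Site → ℝ)) (GExt : Module.End ℝ ((κ × S) × ι → ℝ)),
      -- (ii) THEOREM 3.4 FOR `(Q′G′²Q′*)⁻¹(U′U)`: two-sided inverse with the printed kernel bound (3.48)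
      Tinv * (Qc' ∘ₗ ((gPrimeExtEnd Gp (conj b (vPrimeConc T U g.eta A blk kQ kF sQ sF cfun) * Gp)) * (gPrimeExtEnd Gp (conj b (vPrimeConc T U g.eta A blk kQ kF sQ sF cfun) * Gp))) ∘ₗ Qcs') = 1 ∧
      (Qc' ∘ₗ ((gPrimeExtEnd Gp (conj b (vPrimeConc T U g.eta A blk kQ kF sQ sF cfun) * Gp)) * (gPrimeExtEnd Gp (conj b (vPrimeConc T U g.eta A blk kQ kF sQ sF cfun) * Gp))) ∘ₗ Qcs') * Tinv = 1 ∧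
      (∀ y y' : g.Site, |B9Thm34Inv.ker (B9Thm34Inv.vol g d) Tinv y y'| ≤
        B * g.len y ^ (-(4 : ℝ)) * g.len y' ^ (-(d : ℝ)) * Real.exp (-(9 / 25 * δ₀ * g.dist y y'))) ∧
      -- (iii) THEOREM 3.4 FOR `G(U′U)`: two-sided inverse of the concrete `Δ_a(U′U)`, every (3.42)-entry in block-majorant and kernel form
      deltaA (conj b (lapDDLetter T ((g.eta : ℂ)⁻¹) (prodCfg U g.eta A)))
          (conj b (dPrimeLetter T (prodCfg U g.eta A) g.eta))
          (conjHom b (gradLin T ((g.eta : ℂ)⁻¹) (prodCfg U g.eta A)) ∘ₗ (1 - ((Gp ∘ₗ Qcs ∘ₗ Linv ∘ₗ Qc ∘ₗ Gp) + (B9Eq360Vprime.pPrime Gp (gPrimeExtEnd Gp (conj b (vPrimeConc T U g.eta A blk kQ kF sQ sF cfun) * Gp)) (Qcs ∘ₗ secRes rep) (Qcs' ∘ₗ secRes rep) (secConj rep Linv) (secConj rep Tinv) (secExt rep ∘ₗ Qc) (secExt rep ∘ₗ Qc'))))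
            ∘ₗ conjHom b (divLin T ((g.eta : ℂ)⁻¹) (prodCfg U g.eta A))) Qs' a Q' * GExt = 1 ∧
      GExt *
      deltaA (conj b (lapDDLetter T ((g.eta : ℂ)⁻¹) (prodCfg U g.eta A)))
          (conj b (dPrimeLetter T (prodCfg U g.eta A) g.eta))
          (conjHom b (gradLin T ((g.eta : ℂ)⁻¹) (prodCfg U g.eta A)) ∘ₗ (1 - ((Gp ∘ₗ Qcs ∘ₗ Linv ∘ₗ Qc ∘ₗ Gp) + (B9Eq360Vprime.pPrime Gp (gPrimeExtEnd Gp (conj b (vPrimeConc T U g.eta A blk kQ kF sQ sF cfun) * Gp)) (Qcs ∘ₗ secRes rep) (Qcs' ∘ₗ secRes rep) (secConj rep Linv) (secConj rep Tinv) (secExt rep ∘ₗ Qc) (secExt rep ∘ₗ Qc'))))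
            ∘ₗ conjHom b (divLin T ((g.eta : ℂ)⁻¹) (prodCfg U g.eta A))) Qs' a Q' = 1 ∧
      (∀ (X : Module.End ℝ ((κ × S) × ι → ℝ)) (P : g.Site → ℝ), (∀ y, 0 ≤ P y) →
        HasMajorant (g := toB6 g Rr H) (fun q : (κ × S) × ι => blk q.1.2) (X * G)
          (fun a a' => B₀ * P a * Real.exp (-(δ₀ * g.dist a a'))) →
        HasMajorant (g := toB6 g Rr H) (fun q : (κ × S) × ι => blk q.1.2) (X * GExt)
          (fun a a' => B * P a * Real.exp (-(δ₀ / 6 * g.dist a a')))) ∧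
      (∀ Y : Module.End ℝ ((κ × S) × ι → ℝ),
        HasMajorant (g := toB6 g Rr H) (fun q : (κ × S) × ι => blk q.1.2) (G * Y)
          (fun a a' => B₀ * g.len a * Real.exp (-(δ₀ * g.dist a a'))) →
        HasMajorant (g := toB6 g Rr H) (fun q : (κ × S) × ι => blk q.1.2) (GExt * Y)
          (fun a a' => B * g.len a * Real.exp (-(δ₀ / 6 * g.dist a a')))) ∧
      -- all four entries of (3.42) for `G(U′U)` in the printed kernel form
      HasKernelBound (g := toB6 g Rr H) (fun q : (κ × S) × ι => blk q.1.2) v c GExt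
        (fun a a' => B * g.len a ^ 2 * Real.exp (-(1 / 10 * δ₀ * g.dist a a'))) ∧
      (∀ k : κ ⊕ κ, HasKernelBound (g := toB6 g Rr H) (fun q : (κ × S) × ι => blk q.1.2) v c
        (conj b (diffLetter (bT T) (bU U) ((g.eta : ℂ)⁻¹) k) * GExt)
        (fun a a' => B * g.len a * Real.exp (-(1 / 10 * δ₀ * g.dist a a')))) ∧
      (∀ l : κ ⊕ κ, HasKernelBound (g := toB6 g Rr H) (fun q : (κ × S) × ι => blk q.1.2) v c
        (GExt * conj b (diffLetter (bT T) (bU U) ((g.eta : ℂ)⁻¹) l))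
        (fun a a' => B * g.len a * Real.exp (-(1 / 10 * δ₀ * g.dist a a')))) ∧
      (∀ k l : κ ⊕ κ, HasKernelBound (g := toB6 g Rr H) (fun q : (κ × S) × ι => blk q.1.2) v c
        (conj b (diffLetter (bT T) (bU U) ((g.eta : ℂ)⁻¹) k) * GExt * conj b (diffLetter (bT T) (bU U) ((g.eta : ℂ)⁻¹) l))
        (fun a a' => B * Real.exp (-(1 / 10 * δ₀ * g.dist a a')))) := by
  classical
  obtain ⟨a₁, ha₁, B₁', hB₁', HA⟩ := thm34_Gp_final (Rr := Rr) (H := H) b T U blk d δ₀ BG Cq a₀ d₀ M₂ kQ sQ cfun w hBG hCq ha₀ hM₂ hδ₀ hdnn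
    htri hrefl hsym hlen hlenη hη h261 hST hrepr hU1 hd₀B hd₀F hd₀0 hw hcard hkQ hsQ hcfun hΔpGp hGpΔp h342_1 h342_2 h342_3
  obtain ⟨a₂, ha₂, HB⟩ := thm34_Cinv_final (Rr := Rr) (H := H) b T U blk d δ₀ κQ BG B₁ cF Cq a₀ d₀ M₂ kQ sQ cfun w hκQ hBG hB₁ hcF hCq ha₀
    hM₂ hδ₀ hdnn htri hrefl hsym hlen hlenη hη h261 hST hrepr hU1 hd₀B hd₀F hd₀0 hw hcard hkQ hsQ hcfun h342_1 h342_2 hQc hQcs hLinv h348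
  obtain ⟨a₃, ha₃, B₃, hB₃, HC⟩ := thm34_G_kernel_final (Rr := Rr) (H := H) b T U blk d δ₀ B₀ κQ BG B₁ cF Cq a₀ C₀ d₀ M₂ κQb cFb abar kQ sQ
    cfun w hB₀ hκQ hBG hB₁ hcF hCq ha₀ hC₀ hM₂ hδ₀ hκQb hcFb habar hdnn htri hrefl hsym hlen hlenη hη hL h261 hST hrepr hT hU1 h35 hd₀B hd₀F
    hd₀FB hd₀st hd₀loc hd₀0 hw hcard hkQ hsQ hcfun h342_1 h342_2 h342_3 rep hrep hQc hQcs hLinv h348 hQb hQsb ha324 hΔG hGΔ hG hDG hGD hv hc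
    hGk hDGk hGDk hDGDk
  have hcK : 0 ≤ 2 * B₁ * B6.c1 d (2 / 5 * δ₀) (1 / 10) :=
    mul_nonneg (mul_nonneg zero_le_two hB₁.le) (B6RandomWalk.c1_nonneg d (2 / 5 * δ₀) (1 / 10))
  refine ⟨min (min a₁ a₂) a₃, lt_min (lt_min ha₁ ha₂) ha₃, B₁' + 2 * B₁ * B6.c1 d (2 / 5 * δ₀) (1 / 10) + B₃,
    add_nonneg (add_nonneg hB₁' hcK) hB₃, ?_⟩
  intro α₁ hα₁0 hα₁1 A kF sF hkF hsF h337B h337F h337B' h337Bτ h337FB hA hAτB hAτF hAFB hAst hAloc hdAst Qc' Fc Qcs' Fcs h357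
    h357s hFc hFcs P₂ Qs' Q' F₂ F₂s h380 h380s hP₂def hF₂ hF₂s
  have hα₁a : α₁ ≤ a₁ := hα₁1.trans ((min_le_left _ _).trans (min_le_left _ _))
  have hα₁b : α₁ ≤ a₂ := hα₁1.trans ((min_le_left _ _).trans (min_le_right _ _))
  have hα₁c : α₁ ≤ a₃ := hα₁1.trans (min_le_right _ _)
  obtain ⟨i1, i2, hGpL, hGpR⟩ := HA α₁ hα₁0 hα₁a A kF sF hkF hsF h337B h337F h337Bτ hA hAτB
  obtain ⟨Tinv₂, f1, -, hTk⟩ := HB α₁ hα₁0 hα₁b A kF sF hkF hsF h337B hA hAτB h357 h357s hFc hFcs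
  obtain ⟨Tinv, GExt, e1, e2, e3, e4, hLeft, hRight, k1, k2, k3, k4⟩ := HC α₁ hα₁0 hα₁c A kF sF hkF hsF h337B h337F h337B' h337Bτ
    h337FB hA hAτB hAτF hAFB hAst hAloc hdAst h357 h357s hFc hFcs h380 h380s hP₂def hF₂ hF₂s
  -- the two `C⁻¹(U′U)` agree (uniqueness of the two-sided inverse)
  have hTT : Tinv₂ = Tinv := left_inv_eq_right_inv f1 e2
  rw [hTT] at hTk
  -- one constant `B`
  have hle1 : B₁' ≤ B₁' + 2 * B₁ * B6.c1 d (2 / 5 * δ₀) (1 / 10) + B₃ := by linarith only [hcK, hB₃]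
  have hle2 : 2 * B₁ * B6.c1 d (2 / 5 * δ₀) (1 / 10) ≤ B₁' + 2 * B₁ * B6.c1 d (2 / 5 * δ₀) (1 / 10) + B₃ := by linarith only [hB₁', hB₃]
  have hle3 : B₃ ≤ B₁' + 2 * B₁ * B6.c1 d (2 / 5 * δ₀) (1 / 10) + B₃ := by linarith only [hB₁', hcK]
  have hw1 : ∀ a : g.Site, 0 ≤ g.len a := fun a => (hlen a).le
  have hw2 : ∀ a : g.Site, 0 ≤ g.len a ^ 2 := fun a => sq_nonneg _
  refine ⟨i1, i2, fun X P hP0 hX => ?_, fun Y hY => ?_, Tinv, GExt, e1, e2, fun y y' => ?_, e3, e4, fun X P hP0 hXG => ?_, fun Y hGY => ?_,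
    ?_, fun k => ?_, fun l => ?_, fun k l => ?_⟩
  · exact hasMajorant_mono (g := toB6 g Rr H) _ (hGpL X P hP0 hX) fun a a' =>
      mul_le_mul_of_nonneg_right (mul_le_mul_of_nonneg_right hle1 (hP0 a)) (Real.exp_nonneg _)
  · exact hasMajorant_mono (g := toB6 g Rr H) _ (hGpR Y hY) fun a a' =>
      mul_le_mul_of_nonneg_right (mul_le_mul_of_nonneg_right hle1 (hw1 a)) (Real.exp_nonneg _)
  · exact (hTk y y').trans (mul_le_mul_of_nonneg_right (mul_le_mul_of_nonneg_right (mul_le_mul_of_nonneg_right hle2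
      (Real.rpow_nonneg (hlen y).le _)) (Real.rpow_nonneg (hlen y').le _)) (Real.exp_nonneg _))
  · exact hasMajorant_mono (g := toB6 g Rr H) _ (hLeft X P hP0 hXG) fun a a' =>
      mul_le_mul_of_nonneg_right (mul_le_mul_of_nonneg_right hle3 (hP0 a)) (Real.exp_nonneg _)
  · exact hasMajorant_mono (g := toB6 g Rr H) _ (hRight Y hGY) fun a a' =>
      mul_le_mul_of_nonneg_right (mul_le_mul_of_nonneg_right hle3 (hw1 a)) (Real.exp_nonneg _)
  · exact hasKernelBound_mono (g := toB6 g Rr H) _ hv k1 fun a a' =>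
      mul_le_mul_of_nonneg_right (mul_le_mul_of_nonneg_right hle3 (hw2 a)) (Real.exp_nonneg _)
  · exact hasKernelBound_mono (g := toB6 g Rr H) _ hv (k2 k) fun a a' =>
      mul_le_mul_of_nonneg_right (mul_le_mul_of_nonneg_right hle3 (hw1 a)) (Real.exp_nonneg _)
  · exact hasKernelBound_mono (g := toB6 g Rr H) _ hv (k3 l) fun a a' =>
      mul_le_mul_of_nonneg_right (mul_le_mul_of_nonneg_right hle3 (hw1 a)) (Real.exp_nonneg _)
  · exact hasKernelBound_mono (g := toB6 g Rr H) _ hv (k4 k l) fun a a' =>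
      mul_le_mul_of_nonneg_right hle3 (Real.exp_nonneg _)

end SectB

end Literature.MathematicalPhysics.QuantumFieldTheory.Balaban1983to89.B9Thm34SectBFinal

end

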